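import Mathlib.Algebra.Field.ZMod
import Mathlib.Analysis.Asymptotics.Lemmas
import Mathlib.LinearAlgebra.AffineSpace.AffineSubspace.Basic
import Mathlib.LinearAlgebra.FiniteDimensional.Lemmas
import Mathlib.LinearAlgebra.Dimension.Constructions
import Mathlib.Combinatorics.Enumerative.DoubleCounting
import Mathlib.Algebra.BigOperators.Fin
import Mathlib.Data.Fintype.Fin
import Literature.Computability.Complexity.CircuitSemantics
import Literature.Computability.Complexity.CircuitLowerBounds
import Literature.Computability.Complexity.CircuitLowerBoundsLiYang
import Literature.Computability.Complexity.CircuitSizeProofs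
import HarnessLib

/-!
# Gate elimination: out-degrees, troubled gates; Li–Yang's Lemma 3.7 (proved) and Thm. 4.1 (fact)

The combinatorial notions of the gate-elimination method of Find–Golovnev–Hirsch–Kulikov
(FOCS 2016) and Li–Yang (STOC 2022; full version ECCC TR21-023) over the H21 straight-line
circuit model `Literature.Computability.Complexity.Circuit`, for circuits over the full binary basis in the sense of
Li–Yang §2.1 (*simple binary circuits*: every gate has fan-in exactly two and two distinct
predecessor nodes, `Circuit.IsSimpleBinary`):

* `Circuit.fanout C w` — the out-degree of the node `w` (an input `Sum.inl i` or a gate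
  `Sum.inr m`): the number of argument positions of gates of `C` wired to `w` (Li–Yang §2.1,
  "`k`-gate", "`k`-variable"; being the output is a mark, not an edge);
* `Gate.IsAndType g` — `g` is a binary gate computing `((x ⊕ c₁) ∧ (y ⊕ c₂)) ⊕ c₃`
  (Li–Yang §2.1, "∧-type"); `Gate.IsXorType g` — `x ⊕ y ⊕ c` ("⊕-type");
* `Circuit.IsTroubled C j` — gate `j` is *troubled*: an ∧-type gate of out-degree `1` fed by two
  (distinct) input variables of out-degree `2` (Li–Yang Def. 3.1; FGHK16 §3.2.2);
  `Circuit.troubledCount C` — their number, i.e. the potential `Φ(C, ∅)` of the empty packing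
  (Li–Yang Def. 3.5);
* `Circuit.influentialCount C` — the number of *influential* inputs for the empty rdq-source:
  variables of out-degree `≥ 1` (Li–Yang Def. 3.6; no variable is protected when `R = ∅`).

Main results.

* `LiYang2022_troubledCount_le` — **Lemma 3.7 of Li–Yang (= FGHK16, Lemma 3), PROVED**: a
  circuit computing an affine disperser for dimension `d` on `n` variables has at most
  `n/2 + 5d/2` troubled gates (`2 t ≤ n + 5 d`; no simplicity hypothesis is needed). The proof is the printed one
  (ECCC TR15-166 p. 18): double counting (`two_mul_troubledCount_le`: `2t ≤ n + v₂`), a greedy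
  packing of `d` variables of troubled degree `2` pairwise at distance `≥ 3`
  (`exists_far_of_card_ge`), local pin systems killing their troubled gates
  (`exists_good_localPin`: `y := b`, or in the coincident case `y := b` / `x := a` /
  `y := x ⊕ c`), and the resulting `d`-dimensional affine subspace (`pinSubspace`,
  `finrank_pinSubspace`) on which the circuit is constant (`eval_congr_of_killed`).
* `LiYang2022_measure_ge` — Thm. 4.1 of Li–Yang for the empty packing and empty rdq-source at the
  parameters `(α_φ, α_I, α_Q) = (0.2, 9.6, 1.8)`, `δ = 12.8`, of the proof of Thm. 1.1:
  `g + 9.6 · i + 0.2 · t ≥ 12.8 (n - 2d - 2)` — a NAMED FACT (its proof is the gate-elimination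
  case analysis of ECCC TR21-023 §4.1, pp. 19–41, with Lemmas 3.11, 3.12).
* `size_ge_of_measure_ge` — Thm. 3.9 made explicit: the fact implies
  `12.8 (n - 2d - 2) - 9.6 n - 0.2 (n/2 + 5d/2) ≤ |C|` (`= 3.1 n - 26.1 d - 25.6`,
  `size_ge_of_measure_ge'`) for EVERY H21 circuit over `B2 = {f | f.1 ≤ 2}` computing an affine
  disperser for dimension `d`: an H21 `B2`-circuit (gates of arity `0`, `1`, `2`, possibly with
  coinciding wires) on `n ≥ 2` variables is rewired gate by gate into a simple binary circuit
  of the same size computing the same function (`Circuit.binarize`), to which Thm. 4.1 and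
  Lemma 3.7 apply with `i ≤ n`; for `n ≤ 1` or `d = 0` the bound is negative or there is no
  disperser. This is the statement vendored as the named fact `LiYang2022_size_ge` in
  `CircuitLowerBoundsLiYang.lean`; `LiYang2022_size_ge_of_measure_ge` derives that fact from
  `LiYang2022_measure_ge`.
* `li_yang_of_measure_ge` — consequently the fact `LiYang2022_measure_ge` alone implies
  `Literature.Computability.Complexity.li_yang` (pnp.S23, Li–Yang Thm. 1.1: `3.1 n - o(n)`).

## References

* J. Li, T. Yang, *3.1n − o(n) circuit lower bounds for explicit functions*, STOC 2022, §2.1,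
  Def. 3.1, Def. 3.5, Def. 3.6, Lemma 3.7, Thm. 3.9, Thm. 4.1, proof of Thm. 1.1 (§4)
  [LiYang2022]; full version ECCC TR21-023, pp. 7, 13–15, 18–19.
* M. G. Find, A. Golovnev, E. A. Hirsch, A. S. Kulikov, *A better-than-3n lower bound for the
  circuit complexity of an explicit function*, FOCS 2016, §3.2.2 (troubled gates), Lemma 3
  (full version ECCC TR15-166, pp. 11, 18).
* S. Arora, B. Barak, *Computational Complexity* (2009), Def. 6.1, Rem. 6.4, Claim 2.13.
-/

namespace Literature.Computability.Complexity

open Finset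

variable {ι : Type*}

/-! ### Gate types (Li–Yang §2.1) -/

namespace Gate

/-- A gate is *∧-type* if it is a binary gate computing a "quadratic" function
`((x ⊕ c₁) ∧ (y ⊕ c₂)) ⊕ c₃` of its two inputs, for some constants `c₁ c₂ c₃`
(8 of the 16 binary Boolean functions; Li–Yang STOC 2022, §2.1; FGHK 2016, §3.2.2 "and-type").
Phrased with the binary truth table `btable`. [cite: LiYang2022, §2.1] -/
def IsAndType (g : Gate ι) : Prop :=
  g.arity = 2 ∧ ∃ c₁ c₂ c₃ : Bool, ∀ a b : Bool, btable g a b = (((a ^^ c₁) && (b ^^ c₂)) ^^ c₃)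

/-- A gate is *⊕-type* if it is a binary gate computing an affine function `x ⊕ y ⊕ c` depending
on both inputs (Li–Yang STOC 2022, §2.1; FGHK 2016, "xor-type"). [cite: LiYang2022, §2.1] -/
def IsXorType (g : Gate ι) : Prop :=
  g.arity = 2 ∧ ∃ c : Bool, ∀ a b : Bool, btable g a b = ((a ^^ b) ^^ c)

end Gate

namespace Circuit

/-! ### Out-degrees, simple binary circuits, troubled gates (Li–Yang §2.1, §3.1) -/

/-- `C` is a circuit over the full binary basis `B₂` in the sense of Li–Yang §2.1 (a directed
acyclic *graph* whose gates have in-degree exactly `2`): every gate has arity `2` and its two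
argument wires are distinct nodes (no parallel edges). [cite: LiYang2022, §2.1] -/
def IsSimpleBinary (C : Circuit ι) : Prop :=
  ∀ g ∈ C.gates, g.arity = 2 ∧ Function.Injective g.args

section Fanout

variable [DecidableEq ι]

/-- The *out-degree* (fan-out) of the node `w` of the circuit `C` — an input variable
`Sum.inl i` or a gate `Sum.inr m` — : the number of argument positions, over all gates of `C`,
wired to `w`. A node of out-degree exactly `k` is a "`k`-gate" / "`k`-variable"
(Li–Yang STOC 2022, §2.1); being the output wire is not counted (FGHK 2016, Rule 1: outputs are
marked). For gates this is `Circuit.refCount`. [cite: LiYang2022, §2.1] -/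
def fanout (C : Circuit ι) (w : ι ⊕ ℕ) : ℕ :=
  (C.gates.map fun g => (univ.filter fun a : Fin g.arity => g.args a = w).card).sum

/-- Gate `j` of `C` is *troubled*: it is an ∧-type gate of out-degree `1` whose two arguments
are two distinct input variables `x ≠ y`, each of out-degree `2` (Li–Yang STOC 2022, Def. 3.1;
FGHK 2016, §3.2.2). [cite: LiYang2022, Def. 3.1] -/
def IsTroubled (C : Circuit ι) (j : ℕ) : Prop :=
  ∃ hj : j < C.gates.length, (C.gates[j]).IsAndType ∧ C.fanout (.inr j) = 1 ∧
    ∃ x y : ι, x ≠ y ∧ Set.range (C.gates[j]).args = {Sum.inl x, Sum.inl y} ∧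
      C.fanout (.inl x) = 2 ∧ C.fanout (.inl y) = 2

open Classical in
/-- The number of troubled gates of `C`; equivalently the potential `Φ(C, ∅)` of `C` with the
empty packing (Li–Yang STOC 2022, Def. 3.5: number of troubled gates minus the size of the
packing). [cite: LiYang2022, Def. 3.5] -/
noncomputable def troubledCount (C : Circuit ι) : ℕ :=
  ((range C.gates.length).filter fun j => C.IsTroubled j).card

/-- The number of *influential* inputs of `C` with respect to the empty rdq-source: the input
variables of out-degree at least `1` (Li–Yang STOC 2022, Def. 3.6: "a `1⁺`-variable or
protected"; nothing is protected when there are no quadratic equations). [cite: LiYang2022, Def. 3.6] -/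
def influentialCount [Fintype ι] (C : Circuit ι) : ℕ :=
  (univ.filter fun x : ι => 1 ≤ C.fanout (.inl x)).card

/-- There are at most `size` troubled gates. [folklore] -/
theorem troubledCount_le_size (C : Circuit ι) : C.troubledCount ≤ C.size := by
  classical
  unfold troubledCount size
  exact (card_filter_le _ _).trans (card_range _).le

/-- There are at most `|ι|` influential inputs. [folklore] -/
theorem influentialCount_le_card [Fintype ι] (C : Circuit ι) :
    C.influentialCount ≤ Fintype.card ι :=
  (card_filter_le _ _).trans (card_univ (α := ι)).le

/-- The out-degree of a gate is its reference count `refCount`. [folklore] -/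
theorem fanout_inr (C : Circuit ι) (m : ℕ) : C.fanout (.inr m) = C.refCount m := by
  unfold fanout refCount
  congr 1
  refine List.map_congr_left fun g _ => ?_
  congr 1
  ext a
  simp only [mem_filter, mem_univ, true_and]
  cases g.args a <;> simp

/-! ### Rewiring an H21 `B2`-circuit into a simple binary circuit of the same size -/

/-- A dummy input wire different from `w`: the variable `x₀`, unless `w` is `x₀` itself, in which
case `x₁`. [folklore] -/
def dummyWire (x₀ x₁ : ι) (w : ι ⊕ ℕ) : ι ⊕ ℕ :=
  if w = .inl x₀ then .inl x₁ else .inl x₀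

/-- The dummy wire differs from `w` (when `x₀ ≠ x₁`). [folklore] -/
theorem dummyWire_ne {x₀ x₁ : ι} (h : x₀ ≠ x₁) (w : ι ⊕ ℕ) :
    dummyWire x₀ x₁ w ≠ w := by
  unfold dummyWire
  split_ifs with hw
  · rw [hw]; exact fun e => h (Sum.inl_injective e).symm
  · exact fun e => hw e.symm

/-- The dummy wire is an input, never a gate. [folklore] -/
theorem dummyWire_ne_inr (x₀ x₁ : ι) (w : ι ⊕ ℕ) (m : ℕ) : dummyWire x₀ x₁ w ≠ .inr m := by
  unfold dummyWire
  split_ifs <;> exact Sum.inl_ne_inr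

end Fanout

end Circuit

namespace Gate

/-- The first argument wire of a gate (the dummy `x₀` for a gate without arguments). [folklore] -/
def firstWire (g : Gate ι) (x₀ : ι) : ι ⊕ ℕ :=
  if h : 0 < g.arity then g.args ⟨0, h⟩ else .inl x₀

section Binarize

variable [DecidableEq ι]

/-- The second wire of the binarized gate: the gate's second argument if it has one and it
differs from the first wire, else a dummy input different from the first wire. [folklore] -/
def secondWire (g : Gate ι) (x₀ x₁ : ι) : ι ⊕ ℕ :=
  if h : 1 < g.arity then
    (if g.args ⟨1, h⟩ = g.firstWire x₀ then Circuit.dummyWire x₀ x₁ (g.firstWire x₀)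
      else g.args ⟨1, h⟩)
  else Circuit.dummyWire x₀ x₁ (g.firstWire x₀)

/-- The *binarization* of a gate of arity `≤ 2`: the binary gate on the two distinct wires
`(firstWire, secondWire)` computing the same value — a constant gate becomes a trivial binary
gate, a unary gate (or a binary gate with coinciding wires) a degenerate binary gate ignoring
its dummy second wire (trivial and degenerate gates are gates of `B₂`-circuits, Li–Yang §2.1).
[folklore] -/
def binarize (x₀ x₁ : ι) (g : Gate ι) : Gate ι where
  arity := 2
  op v := g.op fun a => if g.args a = g.firstWire x₀ then v 0 else v 1
  args := ![g.firstWire x₀, g.secondWire x₀ x₁]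

/-- The two wires of a binarized gate are distinct. [folklore] -/
theorem secondWire_ne_firstWire {x₀ x₁ : ι} (h : x₀ ≠ x₁) (g : Gate ι) :
    g.secondWire x₀ x₁ ≠ g.firstWire x₀ := by
  unfold secondWire
  split_ifs with h1 h2
  · exact Circuit.dummyWire_ne h _
  · exact h2
  · exact Circuit.dummyWire_ne h _

/-- Every argument wire of a gate of arity `≤ 2` is its first wire or its second wire. [folklore] -/
theorem args_eq_firstWire_or_secondWire (x₀ x₁ : ι) {g : Gate ι} (hg : g.arity ≤ 2)
    (a : Fin g.arity) : g.args a = g.firstWire x₀ ∨ g.args a = g.secondWire x₀ x₁ := by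
  have h0 : 0 < g.arity := Fin.pos a
  have hfw : g.firstWire x₀ = g.args ⟨0, h0⟩ := by simp [firstWire, h0]
  rcases Nat.lt_or_ge a.val 1 with ha | ha
  · left
    rw [hfw]; congr 1; ext; simp only; omega
  · have h1 : 1 < g.arity := lt_of_le_of_lt ha a.isLt
    have haeq : a = ⟨1, h1⟩ := by ext; simp only; omega
    subst haeq
    by_cases heq : g.args ⟨1, h1⟩ = g.firstWire x₀
    · exact Or.inl heq
    · right
      simp [secondWire, h1, heq]

/-- Binarization does not change the value of a gate of arity `≤ 2`. [folklore] -/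
theorem gateValue_binarize (x : ι → Bool) (vals : List Bool) (x₀ x₁ : ι) {g : Gate ι}
    (hg : g.arity ≤ 2) : gateValue x vals (g.binarize x₀ x₁) = gateValue x vals g := by
  unfold gateValue binarize
  simp only
  congr 1
  funext a
  rcases args_eq_firstWire_or_secondWire x₀ x₁ hg a with ha | ha
  · rw [if_pos ha, ha]; rfl
  · by_cases hb : g.args a = g.firstWire x₀
    · rw [if_pos hb, hb]; rfl
    · rw [if_neg hb, ha]; rfl

/-- A back-reference of a binarized gate is a back-reference of the original gate. [folklore] -/
theorem exists_args_eq_inr_of_binarize (x₀ x₁ : ι) (g : Gate ι) (a : Fin 2) (m : ℕ)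
    (ha : (g.binarize x₀ x₁).args a = .inr m) : ∃ a' : Fin g.arity, g.args a' = .inr m := by
  have hfw : g.firstWire x₀ = .inr m → ∃ a' : Fin g.arity, g.args a' = .inr m := by
    intro h
    by_cases h0 : 0 < g.arity
    · rw [firstWire, dif_pos h0] at h
      exact ⟨_, h⟩
    · rw [firstWire, dif_neg h0] at h
      exact absurd h Sum.inl_ne_inr
  fin_cases a
  · exact hfw ha
  · simp only [binarize] at ha
    change g.secondWire x₀ x₁ = .inr m at ha
    unfold secondWire at ha
    split_ifs at ha with h1 h2
    · exact absurd ha (Circuit.dummyWire_ne_inr _ _ _ _)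
    · exact ⟨_, ha⟩
    · exact absurd ha (Circuit.dummyWire_ne_inr _ _ _ _)

end Binarize

end Gate

/-- Mapping the gates of a straight-line program by a value-preserving map preserves the
transcript. [folklore] -/
theorem transcript_map_of_gateValue_eq (x : ι → Bool) (φ : Gate ι → Gate ι) :
    ∀ (gs : List (Gate ι)), (∀ g ∈ gs, ∀ vals, gateValue x vals (φ g) = gateValue x vals g) →
      ∀ vals, transcript x vals (gs.map φ) = transcript x vals gs
  | [], _, _ => rfl
  | g :: gs, h, vals => by
    rw [List.map_cons, transcript_cons, transcript_cons, h g (by simp) vals]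
    exact transcript_map_of_gateValue_eq x φ gs (fun g' hg' => h g' (by simp [hg'])) _

namespace Circuit

/-- Mapping the gates of a circuit by a map that creates no new back-references yields a
circuit (same output wire). [folklore] -/
def mapGates (C : Circuit ι) (φ : Gate ι → Gate ι)
    (hφ : ∀ (g : Gate ι) (a : Fin (φ g).arity) (m : ℕ), (φ g).args a = .inr m →
      ∃ a' : Fin g.arity, g.args a' = .inr m) : Circuit ι where
  gates := C.gates.map φ
  output := C.output
  wf j hj a m ha := by
    have hj' : j < C.gates.length := by simpa using hj
    have key : ∀ g' : Gate ι, g' = φ (C.gates[j]) →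
        ∀ (a : Fin g'.arity) (m : ℕ), g'.args a = .inr m → m < j := by
      rintro g' rfl a m ha
      obtain ⟨a', ha'⟩ := hφ _ a m ha
      exact C.wf j hj' a' m ha'
    exact key _ (List.getElem_map ..) a m ha
  wf_output m hm := by
    rw [List.length_map]
    exact C.wf_output m hm

/-- A value-preserving gate map preserves the computed function. [folklore] -/
theorem eval_mapGates (C : Circuit ι) (φ : Gate ι → Gate ι)
    (hφ : ∀ (g : Gate ι) (a : Fin (φ g).arity) (m : ℕ), (φ g).args a = .inr m →
      ∃ a' : Fin g.arity, g.args a' = .inr m)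
    (hval : ∀ g ∈ C.gates, ∀ (x : ι → Bool) vals, gateValue x vals (φ g) = gateValue x vals g)
    (x : ι → Bool) : (C.mapGates φ hφ).eval x = C.eval x := by
  rw [eval_eq_wireVal, eval_eq_wireVal]
  change wireVal x (transcript x [] (C.gates.map φ)) C.output = _
  rw [transcript_map_of_gateValue_eq x φ C.gates (fun g hg vals => hval g hg x vals) []]

section Binarize

variable [DecidableEq ι]

/-- The *binarization* of a circuit with respect to two input variables `x₀ ≠ x₁`: every gate is
replaced by its binarization (`Gate.binarize`). For a circuit over `B2` (arities `≤ 2`) this is a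
simple binary circuit of the same size computing the same function
(`isSimpleBinary_binarize`, `size_binarize`, `eval_binarize`). [folklore] -/
def binarize (C : Circuit ι) (x₀ x₁ : ι) : Circuit ι :=
  C.mapGates (Gate.binarize x₀ x₁) (Gate.exists_args_eq_inr_of_binarize x₀ x₁)

/-- Binarization preserves the number of gates. [folklore] -/
@[simp] theorem size_binarize (C : Circuit ι) (x₀ x₁ : ι) :
    (C.binarize x₀ x₁).size = C.size :=
  List.length_map ..

/-- Binarization of a circuit over `B2` preserves the computed function. [folklore] -/
theorem eval_binarize (C : Circuit ι) (hB : C.IsOver B2) (x₀ x₁ : ι) (x : ι → Bool) :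
    (C.binarize x₀ x₁).eval x = C.eval x :=
  C.eval_mapGates _ _ (fun g hg x vals => Gate.gateValue_binarize x vals x₀ x₁ (hB g hg)) x

/-- Binarization of a circuit over `B2` preserves `Computes`. [folklore] -/
theorem computes_binarize {C : Circuit ι} (hB : C.IsOver B2) {f : (ι → Bool) → Bool}
    (hf : C.Computes f) (x₀ x₁ : ι) : (C.binarize x₀ x₁).Computes f :=
  fun x => (C.eval_binarize hB x₀ x₁ x).trans (hf x)

/-- The binarization with respect to two distinct variables is a simple binary circuit.
[folklore] -/
theorem isSimpleBinary_binarize (C : Circuit ι) {x₀ x₁ : ι} (h : x₀ ≠ x₁) :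
    (C.binarize x₀ x₁).IsSimpleBinary := by
  intro g hg
  change g ∈ C.gates.map (Gate.binarize x₀ x₁) at hg
  obtain ⟨g₀, -, rfl⟩ := List.mem_map.mp hg
  refine ⟨rfl, ?_⟩
  have hne := Gate.secondWire_ne_firstWire h g₀
  intro a b hab
  fin_cases a <;> fin_cases b
  · rfl
  · exact absurd hab.symm hne
  · exact absurd hab hne
  · rfl

end Binarize

/-- A simple binary circuit is a circuit over `B2`. [folklore] -/
theorem IsSimpleBinary.isOver_B2 {C : Circuit ι} (h : C.IsSimpleBinary) : C.IsOver B2 :=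
  fun g hg => ((h g hg).1 ▸ le_rfl : g.arity ≤ 2)

end Circuit

end Literature.Computability.Complexity

namespace Literature.Computability.Complexity

/-! ## Part II: the proof of Lemma 3.7 -/

variable {ι : Type*}

namespace Gate

/-- Gate `g` *reads* the input variable `i`: some argument wire of `g` is `i`. [folklore] -/
def Reads (g : Gate ι) (i : ι) : Prop := ∃ a, g.args a = .inl i

/-- All argument wires of `g` are input variables (no back-references). [folklore] -/
def InputsOnly (g : Gate ι) : Prop := ∀ a, ∃ i, g.args a = .inl i

/-- A gate wired to inputs only has a value independent of the earlier gate values. [folklore] -/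
theorem gateValue_eq_of_inputsOnly {g : Gate ι} (hg : g.InputsOnly) (x : ι → Bool)
    (vals vals' : List Bool) : gateValue x vals g = gateValue x vals' g := by
  unfold gateValue
  congr 1
  funext a
  obtain ⟨i, hi⟩ := hg a
  rw [hi]
  rfl

/-- For a binary gate, `gateValue` is the binary truth table `btable` applied to the values of
the two wires. [folklore] -/
theorem gateValue_eq_btable {g : Gate ι} (h2 : g.arity = 2) (x : ι → Bool) (vals : List Bool) :
    gateValue x vals g =
      btable g (wireVal x vals (g.args ⟨0, by omega⟩)) (wireVal x vals (g.args ⟨1, by omega⟩)) := by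
  unfold gateValue btable
  congr 1
  funext a
  by_cases ha : a.val = 0
  · rw [if_pos ha]
    congr 2
    exact Fin.ext ha
  · rw [if_neg ha]
    congr 2
    exact Fin.ext (by have := a.isLt; simp only; omega)

end Gate

/-- **Transcript congruence.** Let `x`, `x'` be two inputs. If every gate of the list either reads
no variable on which `x` and `x'` differ, or is wired to inputs only and takes the same value
under `x` and `x'` (a *killed* gate), then the transcripts under `x` and `x'` coincide.
(The semantic step "leave `C` independent of `x`" of FGHK 2016, Lemma 3.) [folklore] -/
theorem transcript_congr_of_killed (x x' : ι → Bool) :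
    ∀ (gs : List (Gate ι)) (vals : List Bool),
      (∀ g ∈ gs, (∀ (a : Fin g.arity) (i : ι), g.args a = .inl i → x i = x' i) ∨
        (g.InputsOnly ∧ ∀ vals, gateValue x vals g = gateValue x' vals g)) →
      transcript x vals gs = transcript x' vals gs
  | [], _, _ => rfl
  | g :: gs, vals, h => by
    rw [transcript_cons, transcript_cons]
    have hg : gateValue x vals g = gateValue x' vals g := by
      rcases h g (by simp) with h1 | ⟨-, h2⟩
      · unfold gateValue
        congr 1
        funext a
        cases ha : g.args a with
        | inl i => exact h1 a i ha
        | inr m => rfl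
      · exact h2 vals
    rw [hg]
    exact transcript_congr_of_killed x x' gs _ (fun g' hg' => h g' (by simp [hg']))

/-- **Output congruence.** Under the hypotheses of `transcript_congr_of_killed` for all gates of a
circuit whose output wire is a gate (or an unchanged input), the outputs under `x` and `x'`
coincide. [folklore] -/
theorem Circuit.eval_congr_of_killed (C : Circuit ι) (x x' : ι → Bool)
    (h : ∀ g ∈ C.gates, (∀ (a : Fin g.arity) (i : ι), g.args a = .inl i → x i = x' i) ∨
      (g.InputsOnly ∧ ∀ vals, gateValue x vals g = gateValue x' vals g))
    (hout : ∀ i, C.output = .inl i → x i = x' i) : C.eval x = C.eval x' := by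
  rw [eval_eq_wireVal, eval_eq_wireVal, transcript_congr_of_killed x x' C.gates [] h]
  cases ho : C.output with
  | inl i => exact hout i ho
  | inr m => rfl

namespace Gate

/-! ### Killing an ∧-type gate fed by two variables -/

/-- An ∧-type gate whose wires are the variables `p` (slot 0) and `q` (slot 1) computes
`((x p ⊕ c₁) ∧ (x q ⊕ c₂)) ⊕ c₃`. [cite: LiYang2022, §2.1] -/
theorem IsAndType.gateValue_eq {g : Gate ι} (hg : g.IsAndType) {p q : ι}
    (hp : g.args ⟨0, by rw [hg.1]; omega⟩ = .inl p) (hq : g.args ⟨1, by rw [hg.1]; omega⟩ = .inl q) :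
    ∃ c₁ c₂ c₃ : Bool, ∀ (x : ι → Bool) (vals : List Bool),
      gateValue x vals g = (((x p ^^ c₁) && (x q ^^ c₂)) ^^ c₃) := by
  obtain ⟨h2, c₁, c₂, c₃, htab⟩ := hg
  refine ⟨c₁, c₂, c₃, fun x vals => ?_⟩
  rw [gateValue_eq_btable h2, hp, hq]
  exact htab _ _

/-- **Killing by the second variable.** For an ∧-type gate on the variables `(p, q)` there are
constants `b`, `c` such that the gate takes the value `c` on every input with `x q = b`
(FGHK 2016, proof of Lemma 3; Li–Yang §1.3). [cite: LiYang2022, §1.3] -/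
theorem IsAndType.exists_kill_right {g : Gate ι} (hg : g.IsAndType) {p q : ι}
    (hp : g.args ⟨0, by rw [hg.1]; omega⟩ = .inl p) (hq : g.args ⟨1, by rw [hg.1]; omega⟩ = .inl q) :
    ∃ b c : Bool, ∀ (x : ι → Bool) (vals : List Bool), x q = b → gateValue x vals g = c := by
  obtain ⟨c₁, c₂, c₃, h⟩ := hg.gateValue_eq hp hq
  refine ⟨c₂, c₃, fun x vals hx => ?_⟩
  rw [h, hx, Bool.xor_self, Bool.and_false, Bool.false_xor]

/-- **Killing by the first variable.** Symmetrically there are constants `a`, `c` such that the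
gate takes the value `c` on every input with `x p = a`. [cite: LiYang2022, §1.3] -/
theorem IsAndType.exists_kill_left {g : Gate ι} (hg : g.IsAndType) {p q : ι}
    (hp : g.args ⟨0, by rw [hg.1]; omega⟩ = .inl p) (hq : g.args ⟨1, by rw [hg.1]; omega⟩ = .inl q) :
    ∃ a c : Bool, ∀ (x : ι → Bool) (vals : List Bool), x p = a → gateValue x vals g = c := by
  obtain ⟨c₁, c₂, c₃, h⟩ := hg.gateValue_eq hp hq
  refine ⟨c₁, c₃, fun x vals hx => ?_⟩
  rw [h, hx, Bool.xor_self, Bool.false_and, Bool.false_xor]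

/-- An ∧-type gate on two variables (in either slot order) reading the variable `y` is killed by
pinning `y`: there are constants `b`, `c` with value `c` whenever `x y = b`. [cite: LiYang2022, §1.3] -/
theorem IsAndType.exists_kill {g : Gate ι} (hg : g.IsAndType) {p q y : ι}
    (hp : g.args ⟨0, by rw [hg.1]; omega⟩ = .inl p) (hq : g.args ⟨1, by rw [hg.1]; omega⟩ = .inl q)
    (hy : y = p ∨ y = q) :
    ∃ b c : Bool, ∀ (x : ι → Bool) (vals : List Bool), x y = b → gateValue x vals g = c := by
  rcases hy with rfl | rfl
  · exact hg.exists_kill_left hp hq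
  · exact hg.exists_kill_right hp hq

/-- A binary gate wired to two input variables is wired to inputs only. [folklore] -/
theorem inputsOnly_of_args {g : Gate ι} (h2 : g.arity = 2) {p q : ι}
    (hp : g.args ⟨0, by omega⟩ = .inl p) (hq : g.args ⟨1, by omega⟩ = .inl q) : g.InputsOnly := by
  intro a
  by_cases ha : a.val = 0
  · exact ⟨p, by rw [← hp]; congr 1; exact Fin.ext ha⟩
  · exact ⟨q, by rw [← hq]; congr 1; exact Fin.ext (by have := a.isLt; simp only; omega)⟩

end Gate


/-! ### A greedy packing lemma (the selection of `X ⊆ T` in FGHK 2016, Lemma 3) -/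

/-- **Greedy packing.** Let `R x` be a "ball" around `x` (reflexive, symmetric membership) with at
most `5` elements. Then any finite set `T` with `5 k ≤ |T|` contains `k` elements that are
pairwise far apart (no one in the ball of another). In FGHK 2016, Lemma 3, `R x` consists of `x`,
its at most two neighbours `y₁, y₂` and their at most two further neighbours. [folklore] -/
theorem exists_far_subset {α : Type*} [DecidableEq α] (R : α → Finset α)
    (hrefl : ∀ x, x ∈ R x) (hcard : ∀ x, (R x).card ≤ 5) (hsymm : ∀ x z, z ∈ R x → x ∈ R z) :
    ∀ (k : ℕ) (T : Finset α), 5 * k ≤ T.card →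
      ∃ X ⊆ T, X.card = k ∧ ∀ x ∈ X, ∀ x' ∈ X, x ≠ x' → x' ∉ R x
  | 0, T, _ => ⟨∅, Finset.empty_subset _, Finset.card_empty, by simp⟩
  | k + 1, T, hT => by
    obtain ⟨x, hx⟩ : T.Nonempty := Finset.card_pos.mp (by omega)
    have hsplit := Finset.card_filter_add_card_filter_not (s := T) (fun z => z ∉ R x)
    have hle : (T.filter fun z => ¬ z ∉ R x).card ≤ (R x).card :=
      Finset.card_le_card fun z hz => by
        have := (Finset.mem_filter.mp hz).2
        push Not at this
        exact this
    have hT' : 5 * k ≤ (T.filter fun z => z ∉ R x).card := by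
      have := hcard x
      omega
    obtain ⟨X', hX'T', hcardX', hfar⟩ :=
      exists_far_subset R hrefl hcard hsymm k (T.filter fun z => z ∉ R x) hT'
    have hxT' : x ∉ T.filter fun z => z ∉ R x := fun h => (Finset.mem_filter.mp h).2 (hrefl x)
    have hxX' : x ∉ X' := fun h => hxT' (hX'T' h)
    refine ⟨insert x X', ?_, ?_, ?_⟩
    · intro z hz
      rcases Finset.mem_insert.mp hz with rfl | hz
      · exact hx
      · exact (Finset.mem_filter.mp (hX'T' hz)).1
    · rw [Finset.card_insert_of_notMem hxX', hcardX']
    · intro z hz z' hz' hne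
      rw [Finset.mem_insert] at hz hz'
      rcases hz with rfl | hz
      · rcases hz' with rfl | hz'
        · exact absurd rfl hne
        · exact (Finset.mem_filter.mp (hX'T' hz')).2
      · rcases hz' with rfl | hz'
        · intro hmem
          exact (Finset.mem_filter.mp (hX'T' hz)).2 (hsymm _ _ hmem)
        · exact hfar z hz z' hz' hne


/-! ### Double counting the wires into troubled gates (FGHK 2016, Lemma 3: `2t = v₁ + 2v₂`) -/

namespace Circuit

variable [DecidableEq ι]

/-- Gate `j` of `C` reads the input variable `x`. [folklore] -/
def GateReads (C : Circuit ι) (j : ℕ) (x : ι) : Prop :=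
  ∃ hj : j < C.gates.length, (C.gates[j]).Reads x

open Classical in
/-- The number of troubled gates of `C` reading the variable `x` (its degree in the graph whose
edges are the troubled gates; FGHK 2016, proof of Lemma 3). [folklore] -/
noncomputable def troubledDeg (C : Circuit ι) (x : ι) : ℕ :=
  ((Finset.range C.gates.length).filter fun j => C.IsTroubled j ∧ C.GateReads j x).card

/-- The out-degree as a sum over gate indices. [folklore] -/
theorem fanout_eq_sum (C : Circuit ι) (w : ι ⊕ ℕ) :
    C.fanout w = ∑ j : Fin C.gates.length,
      (Finset.univ.filter fun a : Fin (C.gates[(j : ℕ)]).arity =>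
        (C.gates[(j : ℕ)]).args a = w).card := by
  unfold fanout
  rw [← List.ofFn_getElem_eq_map, List.sum_ofFn]

/-- Filtering `range n` is filtering `Fin n`. [folklore] -/
theorem _root_.Finset.card_filter_range_eq_card_filter_univ (n : ℕ) (P : ℕ → Prop)
    [DecidablePred P] :
    ((Finset.range n).filter P).card = (Finset.univ.filter fun j : Fin n => P j).card := by
  have : (Finset.univ.filter fun j : Fin n => P j).map Fin.valEmbedding =
      (Finset.range n).filter P := by
    ext j
    simp only [Finset.mem_map, Finset.mem_filter, Finset.mem_univ, true_and,
      Fin.valEmbedding_apply, Finset.mem_range]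
    constructor
    · rintro ⟨j', hP, rfl⟩
      exact ⟨j'.isLt, hP⟩
    · rintro ⟨hj, hP⟩
      exact ⟨⟨j, hj⟩, hP, rfl⟩
  rw [← this, Finset.card_map]

/-- A variable is read by at most `fanout` many gates; in particular by at most `fanout` many
troubled gates. [folklore] -/
theorem troubledDeg_le_fanout (C : Circuit ι) (x : ι) : C.troubledDeg x ≤ C.fanout (.inl x) := by
  classical
  unfold troubledDeg
  calc ((Finset.range C.gates.length).filter fun j => C.IsTroubled j ∧ C.GateReads j x).card
      ≤ ((Finset.range C.gates.length).filter fun j => C.GateReads j x).card :=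
        Finset.card_le_card (Finset.monotone_filter_right _ fun j _ h => h.2)
    _ = (Finset.univ.filter fun j : Fin C.gates.length => C.GateReads j x).card :=
        Finset.card_filter_range_eq_card_filter_univ _ _
    _ = ∑ j ∈ Finset.univ.filter fun j : Fin C.gates.length => C.GateReads j x, 1 :=
        Finset.card_eq_sum_ones _
    _ ≤ ∑ j ∈ Finset.univ.filter (fun j : Fin C.gates.length => C.GateReads j x),
          (Finset.univ.filter fun a : Fin (C.gates[(j : ℕ)]).arity =>
            (C.gates[(j : ℕ)]).args a = .inl x).card := by
        refine Finset.sum_le_sum fun j hj => ?_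
        obtain ⟨_, a, ha⟩ := (Finset.mem_filter.mp hj).2
        exact Finset.card_pos.mpr ⟨a, Finset.mem_filter.mpr ⟨Finset.mem_univ _, ha⟩⟩
    _ ≤ ∑ j : Fin C.gates.length, (Finset.univ.filter fun a : Fin (C.gates[(j : ℕ)]).arity =>
            (C.gates[(j : ℕ)]).args a = .inl x).card :=
        Finset.sum_le_sum_of_subset (Finset.filter_subset _ _)
    _ = C.fanout (.inl x) := (C.fanout_eq_sum _).symm

/-- The variables read by a troubled gate are exactly its two (distinct) argument variables.
[folklore] -/
theorem filter_gateReads_eq_pair [Fintype ι] {C : Circuit ι} {j : ℕ}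
    (hj : j < C.gates.length) {x y : ι}
    (hrange : Set.range (C.gates[j]).args = {Sum.inl x, Sum.inl y})
    [DecidablePred fun z => C.GateReads j z] :
    (Finset.univ.filter fun z => C.GateReads j z) = {x, y} := by
  ext z
  simp only [Finset.mem_filter, Finset.mem_univ, true_and, Finset.mem_insert,
    Finset.mem_singleton]
  constructor
  · rintro ⟨hj', a, ha⟩
    have : (Sum.inl z : ι ⊕ ℕ) ∈ Set.range (C.gates[j]).args := ⟨a, ha⟩
    rw [hrange] at this
    rcases this with h | h
    · exact Or.inl (Sum.inl_injective h)
    · exact Or.inr (Sum.inl_injective h)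
  · intro h
    have hmem : (Sum.inl z : ι ⊕ ℕ) ∈ Set.range (C.gates[j]).args := by
      rw [hrange]
      rcases h with rfl | rfl
      · exact Or.inl rfl
      · exact Or.inr rfl
    obtain ⟨a, ha⟩ := hmem
    exact ⟨hj, a, ha⟩

/-- A variable read by a troubled gate has out-degree `2`, hence reads into at most `2` troubled
gates: `troubledDeg ≤ 2`. [folklore] -/
theorem troubledDeg_le_two (C : Circuit ι) (x : ι) : C.troubledDeg x ≤ 2 := by
  classical
  by_cases h : C.troubledDeg x = 0
  · omega
  · obtain ⟨j, hj⟩ := Finset.card_pos.mp (Nat.pos_of_ne_zero h)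
    obtain ⟨-, ⟨hjlt, hand, hfan, x', y', hne, hrange, hx', hy'⟩, ⟨_, a, ha⟩⟩ :=
      Finset.mem_filter.mp hj
    have hmem : (Sum.inl x : ι ⊕ ℕ) ∈ Set.range (C.gates[j]).args := ⟨a, ha⟩
    rw [hrange] at hmem
    have hfx : C.fanout (.inl x) = 2 := by
      rcases hmem with h | h
      · rw [Sum.inl_injective h]; exact hx'
      · rw [Sum.inl_injective h]; exact hy'
    exact (C.troubledDeg_le_fanout x).trans hfx.le

/-- **Double counting** (FGHK 2016, proof of Lemma 3: `2t = v₁ + 2 v₂ ≤ n + v₂`). Twice the number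
of troubled gates is the total troubled degree, which is at most the number of variables plus the
number `v₂` of variables of troubled degree `2`. [folklore] -/
theorem two_mul_troubledCount_le [Fintype ι] (C : Circuit ι) :
    2 * C.troubledCount ≤
      Fintype.card ι + (Finset.univ.filter fun x => 2 ≤ C.troubledDeg x).card := by
  classical
  set TJ := (Finset.range C.gates.length).filter fun j => C.IsTroubled j with hTJ
  -- 2 t = Σ_{j ∈ TJ} #{variables read by j}
  have h1 : 2 * C.troubledCount = ∑ j ∈ TJ, (Finset.univ.filter fun z => C.GateReads j z).card := by
    unfold troubledCount
    rw [← hTJ, Finset.card_eq_sum_ones, Finset.mul_sum]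
    refine Finset.sum_congr rfl fun j hj => ?_
    obtain ⟨-, hjlt, -, -, x, y, hne, hrange, -, -⟩ := Finset.mem_filter.mp hj
    rw [filter_gateReads_eq_pair hjlt hrange, Finset.card_pair hne, mul_one]
  -- double counting
  have h2 : ∑ j ∈ TJ, (Finset.univ.filter fun z => C.GateReads j z).card =
      ∑ z : ι, (TJ.filter fun j => C.GateReads j z).card :=
    Finset.sum_card_bipartiteAbove_eq_sum_card_bipartiteBelow (fun j z => C.GateReads j z)
  have h3 : ∀ z : ι, (TJ.filter fun j => C.GateReads j z).card = C.troubledDeg z := by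
    intro z
    unfold troubledDeg
    rw [hTJ, Finset.filter_filter]
  have h4 : ∀ z : ι, C.troubledDeg z ≤
      (if 1 ≤ C.troubledDeg z then 1 else 0) + (if 2 ≤ C.troubledDeg z then 1 else 0) := by
    intro z
    have := C.troubledDeg_le_two z
    split_ifs <;> omega
  calc 2 * C.troubledCount = ∑ z : ι, C.troubledDeg z := by
        rw [h1, h2]; exact Finset.sum_congr rfl fun z _ => h3 z
    _ ≤ ∑ z : ι, ((if 1 ≤ C.troubledDeg z then 1 else 0) + (if 2 ≤ C.troubledDeg z then 1 else 0)) :=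
        Finset.sum_le_sum fun z _ => h4 z
    _ = (Finset.univ.filter fun z => 1 ≤ C.troubledDeg z).card +
          (Finset.univ.filter fun z => 2 ≤ C.troubledDeg z).card := by
        rw [Finset.sum_add_distrib, Finset.card_filter, Finset.card_filter]
    _ ≤ Fintype.card ι + (Finset.univ.filter fun x => 2 ≤ C.troubledDeg x).card :=
        Nat.add_le_add_right ((Finset.card_filter_le _ _).trans (Finset.card_univ (α := ι)).le) _


/-! ### Neighbours in the troubled graph and balls of radius two (FGHK 2016, Lemma 3) -/

/-- `x` and `y` are *neighbours*: distinct variables feeding a common troubled gate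
(FGHK 2016, proof of Lemma 3). [folklore] -/
def TNeighbour (C : Circuit ι) (x y : ι) : Prop :=
  x ≠ y ∧ ∃ j, C.IsTroubled j ∧ C.GateReads j x ∧ C.GateReads j y

omit [DecidableEq ι] in
/-- The neighbour relation is symmetric. [folklore] -/
theorem TNeighbour.symm [DecidableEq ι] {C : Circuit ι} {x y : ι} (h : C.TNeighbour x y) :
    C.TNeighbour y x := by
  obtain ⟨hne, j, hj, hx, hy⟩ := h
  exact ⟨hne.symm, j, hj, hy, hx⟩

omit [DecidableEq ι] in
/-- The variables read by a troubled gate: membership form. [folklore] -/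
theorem gateReads_iff_of_range {C : Circuit ι} {j : ℕ} (hj : j < C.gates.length) {x y : ι}
    (hrange : Set.range (C.gates[j]).args = {Sum.inl x, Sum.inl y}) (z : ι) :
    C.GateReads j z ↔ z = x ∨ z = y := by
  constructor
  · rintro ⟨hj', a, ha⟩
    have : (Sum.inl z : ι ⊕ ℕ) ∈ Set.range (C.gates[j]).args := ⟨a, ha⟩
    rw [hrange] at this
    rcases this with h | h
    · exact Or.inl (Sum.inl_injective h)
    · exact Or.inr (Sum.inl_injective h)
  · intro h
    have hmem : (Sum.inl z : ι ⊕ ℕ) ∈ Set.range (C.gates[j]).args := by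
      rw [hrange]
      rcases h with rfl | rfl
      · exact Or.inl rfl
      · exact Or.inr rfl
    obtain ⟨a, ha⟩ := hmem
    exact ⟨hj, a, ha⟩

/-- A troubled gate reading `x` reads exactly one other variable `y ≠ x`. [folklore] -/
theorem IsTroubled.exists_other {C : Circuit ι} {j : ℕ} (hT : C.IsTroubled j) {x : ι}
    (hx : C.GateReads j x) :
    ∃ y, x ≠ y ∧ C.GateReads j y ∧ ∀ z, C.GateReads j z ↔ z = x ∨ z = y := by
  obtain ⟨hj, -, -, x', y', hne, hrange, -, -⟩ := hT
  have key := gateReads_iff_of_range hj hrange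
  rcases (key x).mp hx with rfl | rfl
  · exact ⟨y', hne, (key y').mpr (Or.inr rfl), key⟩
  · exact ⟨x', hne.symm, (key x').mpr (Or.inl rfl), fun z => (key z).trans or_comm⟩

section Ball

variable [Fintype ι]

open Classical in
/-- The set of neighbours of `x`. [folklore] -/
noncomputable def nbrs (C : Circuit ι) (x : ι) : Finset ι :=
  Finset.univ.filter fun y => C.TNeighbour x y

open Classical in
/-- The *ball of radius two* around `x` in the troubled graph: `x`, its neighbours, and their
neighbours (the at most five vertices removed per step in FGHK 2016, proof of Lemma 3).
[folklore] -/
noncomputable def ball (C : Circuit ι) (x : ι) : Finset ι :=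
  Finset.univ.filter fun z => z = x ∨ C.TNeighbour x z ∨ ∃ y, C.TNeighbour x y ∧ C.TNeighbour y z

/-- Membership in `nbrs`. [folklore] -/
@[simp] theorem mem_nbrs {C : Circuit ι} {x y : ι} : y ∈ C.nbrs x ↔ C.TNeighbour x y := by
  classical
  simp [nbrs]

/-- Membership in `ball`. [folklore] -/
theorem mem_ball {C : Circuit ι} {x z : ι} :
    z ∈ C.ball x ↔ z = x ∨ C.TNeighbour x z ∨ ∃ y, C.TNeighbour x y ∧ C.TNeighbour y z := by
  classical
  simp [ball]

/-- `x` lies in its own ball. [folklore] -/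
theorem mem_ball_self (C : Circuit ι) (x : ι) : x ∈ C.ball x := mem_ball.mpr (Or.inl rfl)

/-- Ball membership is symmetric. [folklore] -/
theorem mem_ball_symm {C : Circuit ι} {x z : ι} (h : z ∈ C.ball x) : x ∈ C.ball z := by
  rcases mem_ball.mp h with rfl | h | ⟨y, hxy, hyz⟩
  · exact mem_ball_self C _
  · exact mem_ball.mpr (Or.inr (Or.inl h.symm))
  · exact mem_ball.mpr (Or.inr (Or.inr ⟨y, hyz.symm, hxy.symm⟩))

/-- Every variable has at most two neighbours: its troubled gates are at most two
(`troubledDeg ≤ 2`) and each contributes one neighbour. [folklore] -/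
theorem card_nbrs_le_two (C : Circuit ι) (x : ι) : (C.nbrs x).card ≤ 2 := by
  classical
  set TJx := (Finset.range C.gates.length).filter fun j => C.IsTroubled j ∧ C.GateReads j x
  have hsub : C.nbrs x ⊆ TJx.biUnion fun j =>
      (Finset.univ.filter fun z => C.GateReads j z).erase x := by
    intro y hy
    obtain ⟨hne, j, hj, hjx, hjy⟩ := mem_nbrs.mp hy
    refine Finset.mem_biUnion.mpr ⟨j, ?_, ?_⟩
    · exact Finset.mem_filter.mpr ⟨Finset.mem_range.mpr hj.1, hj, hjx⟩
    · exact Finset.mem_erase.mpr ⟨hne.symm, Finset.mem_filter.mpr ⟨Finset.mem_univ _, hjy⟩⟩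
  have hpiece : ∀ j ∈ TJx, ((Finset.univ.filter fun z => C.GateReads j z).erase x).card ≤ 1 := by
    intro j hj
    obtain ⟨-, hT, hjx⟩ := Finset.mem_filter.mp hj
    obtain ⟨y, hne, -, hiff⟩ := hT.exists_other hjx
    have : (Finset.univ.filter fun z => C.GateReads j z) = {x, y} := by
      ext z
      simp [hiff z]
    rw [this, Finset.erase_insert (by simpa using hne)]
    simp
  calc (C.nbrs x).card ≤ (TJx.biUnion fun j =>
        (Finset.univ.filter fun z => C.GateReads j z).erase x).card := Finset.card_le_card hsub
    _ ≤ ∑ j ∈ TJx, ((Finset.univ.filter fun z => C.GateReads j z).erase x).card :=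
        Finset.card_biUnion_le
    _ ≤ ∑ _j ∈ TJx, 1 := Finset.sum_le_sum hpiece
    _ = C.troubledDeg x := by rw [Finset.sum_const, smul_eq_mul, mul_one]; rfl
    _ ≤ 2 := C.troubledDeg_le_two x

/-- A ball of radius two has at most five elements (`1 + 2 + 2`). [folklore] -/
theorem card_ball_le_five (C : Circuit ι) (x : ι) : (C.ball x).card ≤ 5 := by
  classical
  have hsub : C.ball x ⊆ insert x (C.nbrs x ∪ (C.nbrs x).biUnion fun y => (C.nbrs y).erase x) := by
    intro z hz
    rcases mem_ball.mp hz with rfl | h | ⟨y, hxy, hyz⟩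
    · exact Finset.mem_insert_self _ _
    · exact Finset.mem_insert_of_mem (Finset.mem_union_left _ (mem_nbrs.mpr h))
    · by_cases hzx : z = x
      · rw [hzx]; exact Finset.mem_insert_self _ _
      · exact Finset.mem_insert_of_mem (Finset.mem_union_right _
          (Finset.mem_biUnion.mpr ⟨y, mem_nbrs.mpr hxy,
            Finset.mem_erase.mpr ⟨hzx, mem_nbrs.mpr hyz⟩⟩))
  have hpiece : ∀ y ∈ C.nbrs x, ((C.nbrs y).erase x).card ≤ 1 := by
    intro y hy
    have hx : x ∈ C.nbrs y := mem_nbrs.mpr (mem_nbrs.mp hy).symm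
    have := Finset.card_erase_of_mem hx
    have := C.card_nbrs_le_two y
    omega
  calc (C.ball x).card
      ≤ (insert x (C.nbrs x ∪ (C.nbrs x).biUnion fun y => (C.nbrs y).erase x)).card :=
        Finset.card_le_card hsub
    _ ≤ (C.nbrs x ∪ (C.nbrs x).biUnion fun y => (C.nbrs y).erase x).card + 1 :=
        Finset.card_insert_le _ _
    _ ≤ ((C.nbrs x).card + ((C.nbrs x).biUnion fun y => (C.nbrs y).erase x).card) + 1 :=
        Nat.add_le_add_right (Finset.card_union_le _ _) _
    _ ≤ ((C.nbrs x).card + ∑ y ∈ C.nbrs x, ((C.nbrs y).erase x).card) + 1 :=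
        Nat.add_le_add_right (Nat.add_le_add_left Finset.card_biUnion_le _) _
    _ ≤ ((C.nbrs x).card + ∑ _y ∈ C.nbrs x, 1) + 1 :=
        Nat.add_le_add_right (Nat.add_le_add_left (Finset.sum_le_sum hpiece) _) _
    _ ≤ 5 := by
        rw [Finset.sum_const, smul_eq_mul, mul_one]
        have := C.card_nbrs_le_two x
        omega

/-- **The packing step of FGHK 2016, Lemma 3.** If at least `5 d` variables have troubled degree
`2`, there are `d` of them pairwise at distance `≥ 3` in the troubled graph. [folklore] -/
theorem exists_far_of_card_ge (C : Circuit ι) (d : ℕ)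
    (hT : 5 * d ≤ (Finset.univ.filter fun x => 2 ≤ C.troubledDeg x).card) :
    ∃ X ⊆ (Finset.univ.filter fun x => 2 ≤ C.troubledDeg x), X.card = d ∧
      ∀ x ∈ X, ∀ x' ∈ X, x ≠ x' → x' ∉ C.ball x :=
  exists_far_subset C.ball C.mem_ball_self C.card_ball_le_five
    (fun _ _ h => mem_ball_symm h) d _ hT

end Ball

/-! ### Normal form of a troubled gate and the gates reading its variables -/

omit [DecidableEq ι] in
/-- **Normal form.** An ∧-type gate whose argument wires are the two distinct variables `x`, `y`
(in either slot order) computes `((val x ⊕ α) ∧ (val y ⊕ β)) ⊕ γ` for some constants, and is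
wired to inputs only. [cite: LiYang2022, §2.1] -/
theorem exists_normalForm {C : Circuit ι} {j : ℕ} (hj : j < C.gates.length)
    (hand : (C.gates[j]).IsAndType) {x y : ι} (hxy : x ≠ y)
    (hrange : Set.range (C.gates[j]).args = {Sum.inl x, Sum.inl y}) :
    ∃ α β γ : Bool, (C.gates[j]).InputsOnly ∧ ∀ (val : ι → Bool) (vals : List Bool),
      gateValue val vals (C.gates[j]) = (((val x ^^ α) && (val y ^^ β)) ^^ γ) := by
  set g := C.gates[j] with hg
  have h2 : g.arity = 2 := hand.1
  set a0 : ι ⊕ ℕ := g.args ⟨0, by omega⟩ with ha0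
  set a1 : ι ⊕ ℕ := g.args ⟨1, by omega⟩ with ha1
  -- every argument is `a0` or `a1`
  have hargs : ∀ a : Fin g.arity, g.args a = a0 ∨ g.args a = a1 := by
    intro a
    by_cases ha : a.val = 0
    · left; rw [ha0]; congr 1; exact Fin.ext ha
    · right; rw [ha1]; congr 1; exact Fin.ext (by have := a.isLt; simp only; omega)
  have hx : (Sum.inl x : ι ⊕ ℕ) ∈ Set.range g.args := by rw [hrange]; exact Or.inl rfl
  have hy : (Sum.inl y : ι ⊕ ℕ) ∈ Set.range g.args := by rw [hrange]; exact Or.inr rfl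
  have h0 : a0 ∈ Set.range g.args := ⟨_, rfl⟩
  have h1 : a1 ∈ Set.range g.args := ⟨_, rfl⟩
  rw [hrange] at h0 h1
  obtain ⟨bx, hbx⟩ := hx
  obtain ⟨by_, hby⟩ := hy
  have hxy' : (Sum.inl x : ι ⊕ ℕ) ≠ Sum.inl y := fun h => hxy (Sum.inl_injective h)
  -- case analysis on the slot order
  have hcases : (a0 = .inl x ∧ a1 = .inl y) ∨ (a0 = .inl y ∧ a1 = .inl x) := by
    rcases hargs bx with hbx' | hbx' <;> rcases hargs by_ with hby' | hby'
    · exact absurd (hbx.symm.trans (hbx'.trans (hby'.symm.trans hby))) hxy'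
    · exact Or.inl ⟨hbx'.symm.trans hbx, hby'.symm.trans hby⟩
    · exact Or.inr ⟨hby'.symm.trans hby, hbx'.symm.trans hbx⟩
    · exact absurd (hbx.symm.trans (hbx'.trans (hby'.symm.trans hby))) hxy'
  rcases hcases with ⟨hp, hq⟩ | ⟨hp, hq⟩
  · obtain ⟨c₁, c₂, c₃, hval⟩ := hand.gateValue_eq (p := x) (q := y) hp hq
    exact ⟨c₁, c₂, c₃, Gate.inputsOnly_of_args h2 hp hq, hval⟩
  · obtain ⟨c₁, c₂, c₃, hval⟩ := hand.gateValue_eq (p := y) (q := x) hp hq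
    refine ⟨c₂, c₁, c₃, Gate.inputsOnly_of_args h2 hp hq, fun val vals => ?_⟩
    rw [hval, Bool.and_comm]

/-- If the variable `x` has out-degree `2` and is read by the distinct gates `j₁`, `j₂`, then no
other gate reads it. [folklore] -/
theorem eq_or_eq_of_gateReads {C : Circuit ι} {x : ι} (hfan : C.fanout (.inl x) = 2)
    {j₁ j₂ : ℕ} (hne : j₁ ≠ j₂) (h₁ : C.GateReads j₁ x) (h₂ : C.GateReads j₂ x) {j : ℕ}
    (hj : C.GateReads j x) : j = j₁ ∨ j = j₂ := by
  by_contra hcon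
  push Not at hcon
  obtain ⟨hj₁, a₁, ha₁⟩ := h₁
  obtain ⟨hj₂, a₂, ha₂⟩ := h₂
  obtain ⟨hjl, a, ha⟩ := hj
  let slots : Fin C.gates.length → ℕ := fun k =>
    (Finset.univ.filter fun b : Fin (C.gates[(k : ℕ)]).arity =>
      (C.gates[(k : ℕ)]).args b = .inl x).card
  have hsum : C.fanout (.inl x) = ∑ k, slots k := C.fanout_eq_sum _
  have hpos : ∀ (k : Fin C.gates.length) (b : Fin (C.gates[(k : ℕ)]).arity),
      (C.gates[(k : ℕ)]).args b = .inl x → 1 ≤ slots k := fun k b hb =>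
    Finset.card_pos.mpr ⟨b, Finset.mem_filter.mpr ⟨Finset.mem_univ _, hb⟩⟩
  set k₁ : Fin C.gates.length := ⟨j₁, hj₁⟩
  set k₂ : Fin C.gates.length := ⟨j₂, hj₂⟩
  set k : Fin C.gates.length := ⟨j, hjl⟩
  have hk12 : k₁ ≠ k₂ := fun h => hne (by simpa [k₁, k₂] using congrArg Fin.val h)
  have hk1 : k ≠ k₁ := fun h => hcon.1 (by simpa [k, k₁] using congrArg Fin.val h)
  have hk2 : k ≠ k₂ := fun h => hcon.2 (by simpa [k, k₂] using congrArg Fin.val h)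
  have hsub : ({k, k₁, k₂} : Finset (Fin C.gates.length)) ⊆ Finset.univ := Finset.subset_univ _
  have h3 : 3 ≤ ∑ i ∈ ({k, k₁, k₂} : Finset (Fin C.gates.length)), slots i := by
    rw [Finset.sum_insert (by simp [hk1, hk2]), Finset.sum_insert (by simpa using hk12),
      Finset.sum_singleton]
    have := hpos k a ha
    have := hpos k₁ a₁ ha₁
    have := hpos k₂ a₂ ha₂
    omega
  have := Finset.sum_le_sum_of_subset (f := slots) hsub
  omega

/-! ### Local pin systems (the substitutions of FGHK 2016, Lemma 3) -/

/-- A *local pin system*: a free variable and, for some variables `z`, a pin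
`val z = (s ∧ val free) ⊕ c` (`s = false`: the constant `c`; `s = true`: `val free ⊕ c`).
[folklore] -/
structure LocalPin (ι : Type*) where
  /-- the free variable -/
  free : ι
  /-- the pinned variables with their pins `(s, c)` -/
  pin : ι → Option (Bool × Bool)
  /-- the free variable is not pinned -/
  pin_free : pin free = none

/-- An input satisfies the pins. [folklore] -/
def LocalPin.Sat (lp : LocalPin ι) (val : ι → Bool) : Prop :=
  ∀ z s c, lp.pin z = some (s, c) → val z = ((s && val lp.free) ^^ c)

/-- A variable *moves with* the free variable: it is the free variable or pinned to it
(`s = true`). [folklore] -/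
def LocalPin.Moves (lp : LocalPin ι) (i : ι) : Prop :=
  i = lp.free ∨ ∃ c, lp.pin i = some (true, c)

/-- `i` is within distance one of `x` in the troubled graph. [folklore] -/
def Close (C : Circuit ι) (x i : ι) : Prop := i = x ∨ C.TNeighbour x i

/-- A local pin system is *good for `x`*: everything it touches is within distance one of `x`,
and every gate reading a moving variable is wired to inputs only and is *killed* (constant on
all inputs satisfying the pins). [folklore] -/
structure LocalPin.Good (C : Circuit ι) (x : ι) (lp : LocalPin ι) : Prop where
  close_free : C.Close x lp.free
  close_pin : ∀ z, lp.pin z ≠ none → C.Close x z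
  kill : ∀ (j : ℕ) (hj : j < C.gates.length), (∃ i, C.GateReads j i ∧ lp.Moves i) →
    (C.gates[j]).InputsOnly ∧ ∃ κ : Bool, ∀ val : ι → Bool, lp.Sat val →
      ∀ vals, gateValue val vals (C.gates[j]) = κ

/-- The Boolean heart of the coincident case of FGHK 2016, Lemma 3: two ∧-type gates on the
same pair of variables are simultaneously killed by `y := b`, by `x := a`, or by `y := x ⊕ c`.
[folklore] -/
theorem bool_three_cases (α₁ β₁ α₂ β₂ : Bool) :
    β₁ = β₂ ∨ α₁ = α₂ ∨ (α₁ ^^ β₁) = (α₂ ^^ β₂) := by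
  revert α₁ β₁ α₂ β₂; decide

/-- **Existence of a good local pin system** at a variable of troubled degree `2`
(FGHK 2016, proof of Lemma 3: "it is possible to assign constants to `y₁` and `y₂` to make `C`
independent of `x` … if `y₁` coincides with `y₂` then either `x = c`, or `y₁ = c`, or
`y₁ = x ⊕ c` eliminates both troubled gates"). [folklore] -/
theorem exists_good_localPin [Fintype ι] (C : Circuit ι) {x : ι} (hx : 2 ≤ C.troubledDeg x) :
    ∃ lp : LocalPin ι, lp.Good C x := by
  classical
  -- the two troubled gates reading `x`
  have hdeg : C.troubledDeg x = 2 := le_antisymm (C.troubledDeg_le_two x) hx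
  obtain ⟨j₁, j₂, hne, hpair⟩ := Finset.card_eq_two.mp hdeg
  have hj₁ : j₁ ∈ ({j₁, j₂} : Finset ℕ) := by simp
  have hj₂ : j₂ ∈ ({j₁, j₂} : Finset ℕ) := by simp
  rw [← hpair] at hj₁ hj₂
  obtain ⟨-, hT₁, hr₁⟩ := Finset.mem_filter.mp hj₁
  obtain ⟨-, hT₂, hr₂⟩ := Finset.mem_filter.mp hj₂
  -- fanout of x is 2, so only j₁, j₂ read x
  obtain ⟨y₁, hxy₁, hry₁, hiff₁⟩ := hT₁.exists_other hr₁
  obtain ⟨y₂, hxy₂, hry₂, hiff₂⟩ := hT₂.exists_other hr₂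
  obtain ⟨hj₁lt, hand₁, hfo₁, x₁', y₁', hne₁, hrange₁, hfx₁', hfy₁'⟩ := hT₁
  obtain ⟨hj₂lt, hand₂, hfo₂, x₂', y₂', hne₂, hrange₂, hfx₂', hfy₂'⟩ := hT₂
  -- fanouts of x, y₁, y₂ are 2
  have hfan : ∀ {j : ℕ} (hj : j < C.gates.length) {x' y' : ι}
      (hrange : Set.range (C.gates[j]).args = {Sum.inl x', Sum.inl y'})
      (hfx : C.fanout (.inl x') = 2) (hfy : C.fanout (.inl y') = 2) {z : ι},
      C.GateReads j z → C.fanout (.inl z) = 2 := by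
    intro j hj x' y' hrange hfx hfy z hz
    rcases (gateReads_iff_of_range hj hrange z).mp hz with rfl | rfl
    · exact hfx
    · exact hfy
  have hfanx : C.fanout (.inl x) = 2 := hfan hj₁lt hrange₁ hfx₁' hfy₁' hr₁
  have hfany₁ : C.fanout (.inl y₁) = 2 := hfan hj₁lt hrange₁ hfx₁' hfy₁' hry₁
  have hfany₂ : C.fanout (.inl y₂) = 2 := hfan hj₂lt hrange₂ hfx₂' hfy₂' hry₂
  -- ranges in terms of x, yₖ
  have hrange₁' : Set.range (C.gates[j₁]).args = {Sum.inl x, Sum.inl y₁} := by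
    ext w; constructor
    · rintro ⟨a, rfl⟩
      cases hw : (C.gates[j₁]).args a with
      | inl z =>
        rcases (hiff₁ z).mp ⟨hj₁lt, a, hw⟩ with rfl | rfl
        · exact Or.inl rfl
        · exact Or.inr rfl
      | inr m =>
        have : (Sum.inr m : ι ⊕ ℕ) ∈ Set.range (C.gates[j₁]).args := ⟨a, hw⟩
        rw [hrange₁] at this
        rcases this with h | h <;> exact absurd h Sum.inr_ne_inl
    · rintro (rfl | rfl)
      · obtain ⟨_, a, ha⟩ := hr₁
        exact ⟨a, ha⟩
      · obtain ⟨_, a, ha⟩ := hry₁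
        exact ⟨a, ha⟩
  have hrange₂' : Set.range (C.gates[j₂]).args = {Sum.inl x, Sum.inl y₂} := by
    ext w; constructor
    · rintro ⟨a, rfl⟩
      cases hw : (C.gates[j₂]).args a with
      | inl z =>
        rcases (hiff₂ z).mp ⟨hj₂lt, a, hw⟩ with rfl | rfl
        · exact Or.inl rfl
        · exact Or.inr rfl
      | inr m =>
        have : (Sum.inr m : ι ⊕ ℕ) ∈ Set.range (C.gates[j₂]).args := ⟨a, hw⟩
        rw [hrange₂] at this
        rcases this with h | h <;> exact absurd h Sum.inr_ne_inl
    · rintro (rfl | rfl)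
      · obtain ⟨_, a, ha⟩ := hr₂
        exact ⟨a, ha⟩
      · obtain ⟨_, a, ha⟩ := hry₂
        exact ⟨a, ha⟩
  obtain ⟨α₁, β₁, γ₁, hio₁, hval₁⟩ := exists_normalForm hj₁lt hand₁ hxy₁ hrange₁'
  obtain ⟨α₂, β₂, γ₂, hio₂, hval₂⟩ := exists_normalForm hj₂lt hand₂ hxy₂ hrange₂'
  have hT₁' : C.IsTroubled j₁ := ⟨hj₁lt, hand₁, hfo₁, x₁', y₁', hne₁, hrange₁, hfx₁', hfy₁'⟩
  have hT₂' : C.IsTroubled j₂ := ⟨hj₂lt, hand₂, hfo₂, x₂', y₂', hne₂, hrange₂, hfx₂', hfy₂'⟩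
  have hNy₁ : C.TNeighbour x y₁ := ⟨hxy₁, j₁, hT₁', hr₁, hry₁⟩
  have hNy₂ : C.TNeighbour x y₂ := ⟨hxy₂, j₂, hT₂', hr₂, hry₂⟩
  -- readers of x are j₁, j₂
  have hreadx : ∀ j, C.GateReads j x → j = j₁ ∨ j = j₂ :=
    fun j hj => eq_or_eq_of_gateReads hfanx hne hr₁ hr₂ hj
  by_cases hyy : y₁ = y₂
  · -- coincident case: both gates on {x, y}
    subst hyy
    have hready : ∀ j, C.GateReads j y₁ → j = j₁ ∨ j = j₂ :=
      fun j hj => eq_or_eq_of_gateReads hfany₁ hne hry₁ hry₂ hj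
    rcases bool_three_cases α₁ β₁ α₂ β₂ with hβ | hα | hαβ
    · -- pin y := β₁ (= β₂); free x
      refine ⟨⟨x, fun z => if z = y₁ then some (false, β₁) else none, by simp [hxy₁]⟩,
        Or.inl rfl, ?_, ?_⟩
      · intro z hz
        by_cases h : z = y₁
        · exact Or.inr (h ▸ hNy₁)
        · simp [h] at hz
      · intro j hj ⟨i, hji, hmv⟩
        have hjx : C.GateReads j x := by
          rcases hmv with rfl | ⟨c, hc⟩
          · exact hji
          · by_cases h : i = y₁ <;> simp [h] at hc
        have hsat : ∀ val : ι → Bool, LocalPin.Sat ⟨x, fun z => if z = y₁ then some (false, β₁)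
            else none, by simp [hxy₁]⟩ val → val y₁ = β₁ := by
          intro val hval
          have := hval y₁ false β₁ (by simp)
          simpa using this
        rcases hreadx j hjx with rfl | rfl
        · exact ⟨hio₁, γ₁, fun val hval vals => by rw [hval₁, hsat val hval]; simp⟩
        · exact ⟨hio₂, γ₂, fun val hval vals => by rw [hval₂, hsat val hval, ← hβ]; simp⟩
    · -- pin x := α₁ (= α₂); free y
      refine ⟨⟨y₁, fun z => if z = x then some (false, α₁) else none, by simp [Ne.symm hxy₁]⟩,
        Or.inr hNy₁, ?_, ?_⟩
      · intro z hz
        by_cases h : z = x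
        · exact Or.inl h
        · simp [h] at hz
      · intro j hj ⟨i, hji, hmv⟩
        have hjy : C.GateReads j y₁ := by
          rcases hmv with rfl | ⟨c, hc⟩
          · exact hji
          · by_cases h : i = x <;> simp [h] at hc
        have hsat : ∀ val : ι → Bool, LocalPin.Sat ⟨y₁, fun z => if z = x then some (false, α₁)
            else none, by simp [Ne.symm hxy₁]⟩ val → val x = α₁ := by
          intro val hval
          have := hval x false α₁ (by simp)
          simpa using this
        rcases hready j hjy with rfl | rfl
        · exact ⟨hio₁, γ₁, fun val hval vals => by rw [hval₁, hsat val hval]; simp⟩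
        · exact ⟨hio₂, γ₂, fun val hval vals => by rw [hval₂, hsat val hval, ← hα]; simp⟩
    · -- pin y := x ⊕ (α₁ ⊕ β₁ ⊕ 1); free x
      refine ⟨⟨x, fun z => if z = y₁ then some (true, (α₁ ^^ β₁) ^^ true) else none,
        by simp [hxy₁]⟩, Or.inl rfl, ?_, ?_⟩
      · intro z hz
        by_cases h : z = y₁
        · exact Or.inr (h ▸ hNy₁)
        · simp [h] at hz
      · intro j hj ⟨i, hji, hmv⟩
        have hjx : C.GateReads j x := by
          rcases hmv with rfl | ⟨c, hc⟩
          · exact hji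
          · by_cases h : i = y₁
            · subst h
              rcases hready j hji with rfl | rfl
              · exact hr₁
              · exact hr₂
            · simp [h] at hc
        have hsat : ∀ val : ι → Bool, LocalPin.Sat ⟨x, fun z => if z = y₁ then
            some (true, (α₁ ^^ β₁) ^^ true) else none, by simp [hxy₁]⟩ val →
            val y₁ = (val x ^^ ((α₁ ^^ β₁) ^^ true)) := by
          intro val hval
          have := hval y₁ true ((α₁ ^^ β₁) ^^ true) (by simp)
          simpa using this
        rcases hreadx j hjx with rfl | rfl
        · refine ⟨hio₁, γ₁, fun val hval vals => ?_⟩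
          rw [hval₁, hsat val hval]
          cases val x <;> cases α₁ <;> cases β₁ <;> cases γ₁ <;> rfl
        · refine ⟨hio₂, γ₂, fun val hval vals => ?_⟩
          rw [hval₂, hsat val hval]
          revert hαβ
          cases val x <;> cases α₁ <;> cases β₁ <;> cases α₂ <;> cases β₂ <;> cases γ₂ <;> decide
  · -- two distinct neighbours: pin y₁ := β₁, y₂ := β₂; free x
    refine ⟨⟨x, fun z => if z = y₁ then some (false, β₁) else if z = y₂ then some (false, β₂)
      else none, by simp [hxy₁, hxy₂]⟩, Or.inl rfl, ?_, ?_⟩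
    · intro z hz
      by_cases h : z = y₁
      · exact Or.inr (h ▸ hNy₁)
      · by_cases h' : z = y₂
        · exact Or.inr (h' ▸ hNy₂)
        · simp [h, h'] at hz
    · intro j hj ⟨i, hji, hmv⟩
      have hjx : C.GateReads j x := by
        rcases hmv with rfl | ⟨c, hc⟩
        · exact hji
        · by_cases h : i = y₁
          · simp [h] at hc
          · by_cases h' : i = y₂ <;> simp [h, h', Ne.symm hyy] at hc
      have hsat₁ : ∀ val : ι → Bool, LocalPin.Sat ⟨x, fun z => if z = y₁ then some (false, β₁)
          else if z = y₂ then some (false, β₂) else none, by simp [hxy₁, hxy₂]⟩ val →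
          val y₁ = β₁ := by
        intro val hval
        have := hval y₁ false β₁ (by simp)
        simpa using this
      have hsat₂ : ∀ val : ι → Bool, LocalPin.Sat ⟨x, fun z => if z = y₁ then some (false, β₁)
          else if z = y₂ then some (false, β₂) else none, by simp [hxy₁, hxy₂]⟩ val →
          val y₂ = β₂ := by
        intro val hval
        have := hval y₂ false β₂ (by simp [Ne.symm hyy])
        simpa using this
      rcases hreadx j hjx with rfl | rfl
      · exact ⟨hio₁, γ₁, fun val hval vals => by rw [hval₁, hsat₁ val hval]; simp⟩
      · exact ⟨hio₂, γ₂, fun val hval vals => by rw [hval₂, hsat₂ val hval]; simp⟩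


/-- Everything a good local pin system touches is within distance one. [folklore] -/
theorem LocalPin.Good.close_of_touches {C : Circuit ι} {x : ι} {lp : LocalPin ι} (h : lp.Good C x)
    {i : ι} (hi : i = lp.free ∨ lp.pin i ≠ none) : C.Close x i := by
  rcases hi with rfl | hi
  · exact h.close_free
  · exact h.close_pin i hi

/-- Two variables both within distance one of `i` are within distance two of each other.
[folklore] -/
theorem mem_ball_of_close [Fintype ι] {C : Circuit ι} {x x' i : ι} (h : C.Close x i)
    (h' : C.Close x' i) : x' ∈ C.ball x := by
  rcases h with rfl | h <;> rcases h' with rfl | h'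
  · exact C.mem_ball_self _
  · exact mem_ball.mpr (Or.inr (Or.inl h'.symm))
  · exact mem_ball.mpr (Or.inr (Or.inl h))
  · exact mem_ball.mpr (Or.inr (Or.inr ⟨_, h, h'.symm⟩))

/-! ### The affine subspace cut out by a system of disjoint local pins (FGHK 2016, Lemma 3) -/

namespace LocalPin

/-- `lp` *touches* `i`: `i` is its free variable or pinned by it. [folklore] -/
def Touches (lp : LocalPin ι) (i : ι) : Prop := i = lp.free ∨ lp.pin i ≠ none

/-- The direction vector of a local pin system: `1` at the free variable and at the variables
pinned to it (`s = true`). [folklore] -/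
def dir (lp : LocalPin ι) (i : ι) : ZMod 2 :=
  (if i = lp.free then 1 else 0) +
    (match lp.pin i with | some (s, _) => if s then 1 else 0 | none => 0)

/-- The constant vector of a local pin system: the constants `c` of its pins. [folklore] -/
def cst (lp : LocalPin ι) (i : ι) : ZMod 2 :=
  match lp.pin i with | some (_, c) => if c then 1 else 0 | none => 0

/-- The direction vector vanishes off the touched variables. [folklore] -/
theorem dir_eq_zero_of_not_touches {lp : LocalPin ι} {i : ι} (h : ¬ lp.Touches i) :
    lp.dir i = 0 := by
  unfold Touches at h
  push Not at h
  unfold dir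
  rw [if_neg h.1, h.2]
  simp

omit [DecidableEq ι] in
/-- The constant vector vanishes off the touched variables. [folklore] -/
theorem cst_eq_zero_of_not_touches {lp : LocalPin ι} {i : ι} (h : ¬ lp.Touches i) :
    lp.cst i = 0 := by
  unfold Touches at h
  push Not at h
  unfold cst
  rw [h.2]

/-- The direction vector is `1` at the free variable. [folklore] -/
theorem dir_free (lp : LocalPin ι) : lp.dir lp.free = 1 := by
  unfold dir
  rw [if_pos rfl, lp.pin_free]
  simp

omit [DecidableEq ι] in
/-- The constant vector is `0` at the free variable. [folklore] -/
theorem cst_free (lp : LocalPin ι) : lp.cst lp.free = 0 := by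
  unfold cst
  rw [lp.pin_free]

omit [DecidableEq ι] in
/-- A pinned variable is not the free variable. [folklore] -/
theorem ne_free_of_pin {lp : LocalPin ι} {z : ι} {s c : Bool} (h : lp.pin z = some (s, c)) :
    z ≠ lp.free := by
  rintro rfl
  rw [lp.pin_free] at h
  simp at h

/-- The direction vector at a pinned variable is its `s`. [folklore] -/
theorem dir_pin {lp : LocalPin ι} {z : ι} {s c : Bool} (h : lp.pin z = some (s, c)) :
    lp.dir z = if s then 1 else 0 := by
  unfold dir
  rw [if_neg (ne_free_of_pin h), h]
  simp

omit [DecidableEq ι] in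
/-- The constant vector at a pinned variable is its `c`. [folklore] -/
theorem cst_pin {lp : LocalPin ι} {z : ι} {s c : Bool} (h : lp.pin z = some (s, c)) :
    lp.cst z = if c then 1 else 0 := by
  unfold cst
  rw [h]

/-- The direction vector vanishes at variables that do not move with the free variable.
[folklore] -/
theorem dir_eq_zero_of_not_moves {lp : LocalPin ι} {i : ι} (h : ¬ lp.Moves i) : lp.dir i = 0 := by
  unfold Moves at h
  push Not at h
  unfold dir
  rw [if_neg h.1]
  rcases hpin : lp.pin i with _ | ⟨s, c⟩
  · simp
  · cases s
    · simp
    · exact absurd hpin (h.2 c)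

omit [DecidableEq ι] in
/-- Moving variables are touched. [folklore] -/
theorem touches_of_moves {lp : LocalPin ι} {i : ι} (h : lp.Moves i) : lp.Touches i := by
  rcases h with h | ⟨c, hc⟩
  · exact Or.inl h
  · exact Or.inr (by rw [hc]; exact Option.some_ne_none _)

end LocalPin

section PinSystem

variable (X : Finset ι) (lp : ι → LocalPin ι)

/-- The linear part of the pin map: `v ↦ Σ_{x ∈ X} v x • dir (lp x)`. [folklore] -/
noncomputable def pinL : (X → ZMod 2) →ₗ[ZMod 2] (ι → ZMod 2) :=
  ∑ x : X, (LinearMap.proj x : (X → ZMod 2) →ₗ[ZMod 2] ZMod 2).smulRight (lp x).dir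

/-- The constant part of the pin map. [folklore] -/
noncomputable def pin0 : ι → ZMod 2 := ∑ x : X, (lp x).cst

/-- The *pin map*: the affine parametrization `v ↦ pinL v + pin0` of the inputs in which the
variables of `X` are free (coordinates `v`), the pinned variables take their pinned values, and
all other variables are `0` (FGHK 2016, Lemma 3: "`|Y|` consistent linear equations … then we set
all the remaining variables to arbitrary constants"). [folklore] -/
noncomputable def pinMap : (X → ZMod 2) →ᵃ[ZMod 2] (ι → ZMod 2) :=
  ⟨fun v => pinL X lp v + pin0 X lp, pinL X lp, fun p v => by
    rw [vadd_eq_add, vadd_eq_add, map_add, add_assoc]⟩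

/-- Coordinates of the linear part of the pin map. [folklore] -/
theorem pinL_apply (v : X → ZMod 2) (i : ι) : pinL X lp v i = ∑ x : X, v x * (lp x).dir i := by
  simp [pinL, LinearMap.sum_apply, LinearMap.smulRight_apply, Finset.sum_apply, smul_eq_mul]

/-- Coordinates of the pin map. [folklore] -/
theorem pinMap_apply (v : X → ZMod 2) (i : ι) :
    pinMap X lp v i = ∑ x : X, (v x * (lp x).dir i + (lp x).cst i) := by
  change (pinL X lp v + pin0 X lp) i = _
  rw [Pi.add_apply, pinL_apply, pin0, Finset.sum_apply, ← Finset.sum_add_distrib]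

variable {X lp}

/-- Pairwise disjointness of the local pin systems of `X`. [folklore] -/
def PinDisjoint (X : Finset ι) (lp : ι → LocalPin ι) : Prop :=
  ∀ x ∈ X, ∀ x' ∈ X, x ≠ x' → ∀ i, (lp x).Touches i → ¬ (lp x').Touches i

/-- The linear part of the pin map at a free variable returns its coordinate (disjointness).
[folklore] -/
theorem pinL_apply_free (hdis : PinDisjoint X lp) (v : X → ZMod 2) (x₀ : X) :
    pinL X lp v (lp x₀).free = v x₀ := by
  rw [pinL_apply, Finset.sum_eq_single x₀]
  · rw [LocalPin.dir_free, mul_one]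
  · intro x _ hx
    have hne : (x : ι) ≠ x₀ := fun h => hx (Subtype.ext h)
    rw [LocalPin.dir_eq_zero_of_not_touches (hdis _ x₀.2 _ x.2 hne.symm _ (Or.inl rfl)), mul_zero]
  · exact fun h => absurd (Finset.mem_univ _) h

/-- The pin map at the free variable of `x₀` returns the coordinate `v x₀`. [folklore] -/
theorem pinMap_apply_free (hdis : PinDisjoint X lp) (v : X → ZMod 2) (x₀ : X) :
    pinMap X lp v (lp x₀).free = v x₀ := by
  rw [pinMap_apply, Finset.sum_eq_single x₀]
  · rw [LocalPin.dir_free, LocalPin.cst_free, mul_one, add_zero]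
  · intro x _ hx
    have hne : (x : ι) ≠ x₀ := fun h => hx (Subtype.ext h)
    have hnt := hdis _ x₀.2 _ x.2 hne.symm _ (Or.inl rfl)
    rw [LocalPin.dir_eq_zero_of_not_touches hnt, LocalPin.cst_eq_zero_of_not_touches hnt]
    simp
  · exact fun h => absurd (Finset.mem_univ _) h

/-- The pin map at a variable pinned by `x₀` with `(s, c)` returns `s · v x₀ + c`. [folklore] -/
theorem pinMap_apply_pin (hdis : PinDisjoint X lp) (v : X → ZMod 2) (x₀ : X) {z : ι} {s c : Bool}
    (hz : (lp x₀).pin z = some (s, c)) :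
    pinMap X lp v z = (if s then v x₀ else 0) + (if c then 1 else 0) := by
  rw [pinMap_apply, Finset.sum_eq_single x₀]
  · rw [LocalPin.dir_pin hz, LocalPin.cst_pin hz]
    cases s <;> simp
  · intro x _ hx
    have hne : (x : ι) ≠ x₀ := fun h => hx (Subtype.ext h)
    have ht : (lp x₀).Touches z := Or.inr (by rw [hz]; exact Option.some_ne_none _)
    have hnt := hdis _ x₀.2 _ x.2 hne.symm _ ht
    rw [LocalPin.dir_eq_zero_of_not_touches hnt, LocalPin.cst_eq_zero_of_not_touches hnt]
    simp
  · exact fun h => absurd (Finset.mem_univ _) h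

/-- Changing the coordinate of `x₀` only changes the pin map at variables moving with `x₀`.
[folklore] -/
theorem pinMap_update_of_not_moves (v : X → ZMod 2) (x₀ : X) (t : ZMod 2) {i : ι}
    (hi : ¬ (lp x₀).Moves i) : pinMap X lp (Function.update v x₀ t) i = pinMap X lp v i := by
  rw [pinMap_apply, pinMap_apply]
  refine Finset.sum_congr rfl fun x _ => ?_
  by_cases hx : x = x₀
  · subst hx
    rw [LocalPin.dir_eq_zero_of_not_moves hi]
    simp
  · rw [Function.update_of_ne hx]

/-- The linear part of the pin map is injective. [folklore] -/
theorem pinL_injective (hdis : PinDisjoint X lp) : Function.Injective (pinL X lp) := by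
  intro v w h
  funext x₀
  have := congrFun h (lp x₀).free
  rwa [pinL_apply_free hdis, pinL_apply_free hdis] at this

/-- The affine subspace of inputs parametrized by the pin map. [folklore] -/
noncomputable def pinSubspace (X : Finset ι) (lp : ι → LocalPin ι) :
    AffineSubspace (ZMod 2) (ι → ZMod 2) :=
  (⊤ : AffineSubspace (ZMod 2) (X → ZMod 2)).map (pinMap X lp)

/-- Membership in the pin subspace: the points are the values of the pin map. [folklore] -/
theorem mem_pinSubspace_iff {w : ι → ZMod 2} :
    w ∈ pinSubspace X lp ↔ ∃ v : X → ZMod 2, pinMap X lp v = w := by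
  unfold pinSubspace
  rw [AffineSubspace.mem_map]
  constructor
  · rintro ⟨v, -, hv⟩; exact ⟨v, hv⟩
  · rintro ⟨v, hv⟩; exact ⟨v, AffineSubspace.mem_top _ _ _, hv⟩

/-- **Dimension count**: the pin subspace has dimension `|X|` (the linear part is injective
because the free variables are untouched by the other pin systems). [folklore] -/
theorem finrank_pinSubspace (hdis : PinDisjoint X lp) :
    Module.finrank (ZMod 2) (pinSubspace X lp).direction = X.card := by
  unfold pinSubspace
  rw [AffineSubspace.map_direction, AffineSubspace.direction_top, Submodule.map_top]
  change Module.finrank (ZMod 2) (LinearMap.range (pinL X lp)) = X.card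
  rw [LinearMap.finrank_range_of_inj (pinL_injective hdis), Module.finrank_fintype_fun_eq_card,
    Fintype.card_coe]

end PinSystem

/-! ### Bridging `𝔽₂` and `Bool` -/

/-- The inverse bridge `boolOfZMod2.symm` is `finTwoEquiv` componentwise (`0 ↦ false`,
`1 ↦ true`). [folklore] -/
theorem boolOfZMod2_symm_apply {n : ℕ} (w : Fin n → ZMod 2) (z : Fin n) :
    Literature.Computability.Complexity.boolOfZMod2.symm w z = finTwoEquiv (w z) := rfl

/-- The pin equation `s · a + c` over `𝔽₂` read in `Bool`. [folklore] -/
theorem finTwoEquiv_pin (a : ZMod 2) (s c : Bool) :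
    finTwoEquiv (((if s then a else 0) + (if c then 1 else 0) : ZMod 2)) =
      ((s && finTwoEquiv a) ^^ c) := by
  revert a s c
  decide

end Circuit

end Literature.Computability.Complexity

namespace Literature.Computability.Complexity

open Module Filter Asymptotics

/-- No Boolean function is an affine disperser for dimension `0`: it is constant on every
singleton, an affine subspace of dimension `0`. [folklore] -/
theorem not_isAffineDisperser_zero {n : ℕ} (f : (Fin n → ZMod 2) → Bool) :
    ¬ IsAffineDisperser f 0 := by
  intro h
  obtain ⟨x, hx, y, hy, hne⟩ := h (affineSpan (ZMod 2) {(0 : Fin n → ZMod 2)}) (Nat.zero_le _)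
    ⟨0, mem_affineSpan (ZMod 2) (Set.mem_singleton _)⟩
  rw [AffineSubspace.mem_affineSpan_singleton] at hx hy
  rw [hx, hy] at hne
  exact hne rfl


/-! ### Functions of one coordinate are not affine dispersers below dimension `n` -/

/-- A function on `𝔽₂ⁿ` depending only on the coordinate `i` is constant on the hyperplane
`{w | w i = 0}`, an affine subspace of dimension `n - 1`; hence it is not an affine disperser for
any dimension `d ≤ n - 1`. (Used for circuits whose output wire is an input variable.) [folklore] -/
theorem not_isAffineDisperser_of_coord {n d : ℕ} (hd : d + 1 ≤ n) (i : Fin n)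
    (g : ZMod 2 → Bool) : ¬ IsAffineDisperser (fun w : Fin n → ZMod 2 => g (w i)) d := by
  intro h
  set P : (Fin n → ZMod 2) →ₗ[ZMod 2] ZMod 2 := LinearMap.proj i with hP
  have hrange : LinearMap.range P = ⊤ :=
    LinearMap.range_eq_top.mpr fun c => ⟨Pi.single i c, by simp [hP]⟩
  have hfin : finrank (ZMod 2) (LinearMap.ker P) + 1 = n := by
    have h1 := LinearMap.finrank_range_add_finrank_ker (K := ZMod 2) P
    rw [hrange, finrank_top, Module.finrank_self, Module.finrank_fin_fun] at h1
    omega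
  obtain ⟨x, hx, y, hy, hne⟩ := h (LinearMap.ker P).toAffineSubspace
    (by rw [Submodule.toAffineSubspace_direction]; omega) ⟨0, (LinearMap.ker P).zero_mem⟩
  have hx0 : x i = 0 := by simpa [hP] using hx
  have hy0 : y i = 0 := by simpa [hP] using hy
  exact hne (by simp only [hx0, hy0])

/-! ### Lemma 3.7 of Li–Yang (= FGHK16 Lemma 3) -/

/-- The inputs parametrized by the pin map satisfy every local pin system. [folklore] -/
theorem sat_of_pinMap {n : ℕ} {X : Finset (Fin n)} {lp : Fin n → Circuit.LocalPin (Fin n)}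
    (hdis : Circuit.PinDisjoint X lp) (v : X → ZMod 2) (x₀ : X) :
    (lp x₀).Sat (boolOfZMod2.symm (Circuit.pinMap X lp v)) := by
  intro z s c hz
  rw [Circuit.boolOfZMod2_symm_apply, Circuit.boolOfZMod2_symm_apply,
    Circuit.pinMap_apply_pin hdis v x₀ hz, Circuit.pinMap_apply_free hdis v x₀,
    Circuit.finTwoEquiv_pin]

/-- **Lemma 3.7 of Li–Yang** (STOC 2022; = Find–Golovnev–Hirsch–Kulikov 2016, Lemma 3). "Let `C`
be a circuit computing an affine disperser for dimension `d`, then the number of troubled gates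
is at most `n/2 + 5d/2`" (FGHK: "less than"), i.e. `2 t ≤ n + 5 d`. Proved here for EVERY H21
circuit computing an affine disperser for dimension `d` on `n` variables (simplicity is not
needed: `IsTroubled` asks for two distinct argument variables, and the out-degree counts
argument positions). Proof as printed
(ECCC TR15-166, p. 18): double counting gives `2t ≤ n + v₂`; if `v₂ ≥ 5d + 1`, a greedy packing
picks `d` variables of troubled degree `2` pairwise at distance `≥ 3`; pinning their neighbours
(`y := b`, or in the coincident case `y := b` / `x := a` / `y := x ⊕ c`) kills their troubled
gates, so the circuit is constant on the resulting `d`-dimensional affine subspace, contradicting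
the disperser property. [cite: LiYang2022, Lemma 3.7] -/
theorem LiYang2022_troubledCount_le (n d : ℕ) (f : (Fin n → ZMod 2) → Bool)
    (hf : IsAffineDisperser f d) (C : Circuit (Fin n))
    (hC : C.Computes (f ∘ boolOfZMod2)) : 2 * C.troubledCount ≤ n + 5 * d := by
  classical
  by_contra hlt
  push Not at hlt
  have h2t := C.two_mul_troubledCount_le
  rw [Fintype.card_fin] at h2t
  have hTn : (Finset.univ.filter fun x : Fin n => 2 ≤ C.troubledDeg x).card ≤ n :=
    (Finset.card_filter_le _ _).trans (by simp)
  have hT : 5 * d + 1 ≤ (Finset.univ.filter fun x : Fin n => 2 ≤ C.troubledDeg x).card := by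
    omega
  -- `f` in terms of the circuit
  have hfC : ∀ w : Fin n → ZMod 2, f w = C.eval (boolOfZMod2.symm w) := fun w => by
    have := hC (boolOfZMod2.symm w)
    simp only [Function.comp, Equiv.apply_symm_apply] at this
    exact this.symm
  -- the output wire is a gate (else `f` is a coordinate function)
  obtain ⟨m, hm⟩ : ∃ m, C.output = .inr m := by
    cases ho : C.output with
    | inr m => exact ⟨m, rfl⟩
    | inl i =>
      exfalso
      have hfi : f = fun w => finTwoEquiv (w i) := by
        funext w
        rw [hfC w, eval_eq_wireVal, ho]
        rfl
      rw [hfi] at hf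
      exact not_isAffineDisperser_of_coord (by omega) i finTwoEquiv hf
  -- packing and local pins
  obtain ⟨X, hXT, hXcard, hfar⟩ := C.exists_far_of_card_ge d (by omega)
  have hlp : ∀ x : Fin n, ∃ lp : Circuit.LocalPin (Fin n), x ∈ X → lp.Good C x := by
    intro x
    by_cases hx : x ∈ X
    · obtain ⟨lp, h⟩ := C.exists_good_localPin (Finset.mem_filter.mp (hXT hx)).2
      exact ⟨lp, fun _ => h⟩
    · exact ⟨⟨x, fun _ => none, rfl⟩, fun h => absurd h hx⟩
  choose lp hlp using hlp
  have hdis : Circuit.PinDisjoint X lp := by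
    intro x hx x' hx' hne i hti hti'
    exact hfar x hx x' hx' hne
      (Circuit.mem_ball_of_close ((hlp x hx).close_of_touches hti) ((hlp x' hx').close_of_touches hti'))
  -- changing one free coordinate does not change the output
  have hstep : ∀ (v : X → ZMod 2) (x₀ : X) (t : ZMod 2),
      C.eval (boolOfZMod2.symm (Circuit.pinMap X lp (Function.update v x₀ t))) =
        C.eval (boolOfZMod2.symm (Circuit.pinMap X lp v)) := by
    intro v x₀ t
    apply Circuit.eval_congr_of_killed
    · intro g hg
      obtain ⟨j, hj, rfl⟩ := List.mem_iff_getElem.mp hg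
      by_cases hex : ∃ (a : Fin (C.gates[j]).arity) (i : Fin n), (C.gates[j]).args a = .inl i ∧
          boolOfZMod2.symm (Circuit.pinMap X lp (Function.update v x₀ t)) i ≠
            boolOfZMod2.symm (Circuit.pinMap X lp v) i
      · right
        obtain ⟨a, i, ha, hi⟩ := hex
        have hmv : (lp x₀).Moves i := by
          by_contra hmv
          exact hi (by rw [Circuit.boolOfZMod2_symm_apply, Circuit.boolOfZMod2_symm_apply,
            Circuit.pinMap_update_of_not_moves v x₀ t hmv])
        obtain ⟨hio, κ, hκ⟩ := (hlp x₀ x₀.2).kill j hj ⟨i, ⟨hj, a, ha⟩, hmv⟩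
        exact ⟨hio, fun vals => by
          rw [hκ _ (sat_of_pinMap hdis _ x₀) vals, hκ _ (sat_of_pinMap hdis _ x₀) vals]⟩
      · left
        push Not at hex
        exact hex
    · intro i hi
      rw [hm] at hi
      exact absurd hi (by simp)
  -- hence `f` is constant on the pin subspace
  have hconst : ∀ v : X → ZMod 2, f (Circuit.pinMap X lp v) = f (Circuit.pinMap X lp 0) := by
    suffices key : ∀ (s : Finset X) (v : X → ZMod 2), (∀ x ∉ s, v x = 0) →
        f (Circuit.pinMap X lp v) = f (Circuit.pinMap X lp 0) from
      fun v => key Finset.univ v fun x hx => absurd (Finset.mem_univ x) hx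
    intro s
    refine Finset.induction_on s ?_ ?_
    · intro v hv
      have : v = 0 := funext fun x => hv x (Finset.notMem_empty x)
      rw [this]
    · intro x₀ s hx₀ ih v hv
      have hv' : ∀ x ∉ s, Function.update v x₀ 0 x = 0 := by
        intro x hx
        by_cases hxx : x = x₀
        · subst hxx
          simp
        · rw [Function.update_of_ne hxx]
          exact hv x (by simp [hxx, hx])
      rw [← ih _ hv', hfC, hfC]
      exact (hstep v x₀ 0).symm
  -- contradiction with the disperser property on the `d`-dimensional pin subspace
  have hfin : Module.finrank (ZMod 2) (Circuit.pinSubspace X lp).direction = d := by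
    rw [Circuit.finrank_pinSubspace hdis, hXcard]
  have hne : ((Circuit.pinSubspace X lp : AffineSubspace (ZMod 2) (Fin n → ZMod 2)) :
      Set (Fin n → ZMod 2)).Nonempty :=
    ⟨Circuit.pinMap X lp 0, Circuit.mem_pinSubspace_iff.mpr ⟨0, rfl⟩⟩
  obtain ⟨w, hw, w', hw', hneq⟩ := hf (Circuit.pinSubspace X lp) (by rw [hfin]) hne
  obtain ⟨v, rfl⟩ := Circuit.mem_pinSubspace_iff.mp hw
  obtain ⟨v', rfl⟩ := Circuit.mem_pinSubspace_iff.mp hw'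
  exact hneq ((hconst v).trans (hconst v').symm)


/-! ### Li–Yang's Theorem 4.1 as a named fact, and its consequences -/

/-- (Li–Yang, STOC 2022, **Thm. 4.1**, for the empty packing `𝒫 = ∅` and the empty rdq-source
`R = ∅`, at the parameters `α_φ = 0.2`, `α_I = 9.6`, `α_Q = 1.8` of the proof of Thm. 1.1, for
which `δ = α_I + min {α_I/3, 2 - 2α_φ + α_Q, 4 - 4α_φ, 3 + α_φ, 5 - α_Q, (5 - 2α_φ + α_Q)/2}
= 9.6 + 3.2 = 12.8`.) Printed: "Let `C` be a circuit computing an affine disperser `f` for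
dimension `d`. For all packing `𝒫` of `C`, we have `μ(C, 𝒫, ∅) ≥ δ (n - 2d - 2)`", where
`μ(C, 𝒫, R) = g + α_I · i + α_Q · q + α_φ · Φ(C, 𝒫)` (Def. 3.6). For `𝒫 = ∅` the potential
`Φ(C, ∅)` is the number of troubled gates (Def. 3.5), and for `R = ∅` there are no quadratic
equations (`q = 0`) and the influential inputs are the variables of out-degree `≥ 1`; "circuit"
there means fair semicircuit (§2.5), of which a `B₂`-circuit in the sense of §2.1 — here
`Circuit.IsSimpleBinary` — is the basic case. Hence, for every simple binary circuit `C` on `n`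
variables computing an affine disperser for dimension `d`:
`12.8 (n - 2d - 2) ≤ C.size + 9.6 · influentialCount C + 0.2 · troubledCount C`.
Its proof is the gate-elimination case analysis of §4.1 of the full version (ECCC TR21-023,
pp. 19–41) with Lemmas 3.11, 3.12. [cite: LiYang2022, Thm. 4.1 and proof of Thm. 1.1 (§4)] -/
def LiYang2022_measure_ge : Prop :=
  ∀ (n d : ℕ) (f : (Fin n → ZMod 2) → Bool), IsAffineDisperser f d →
    ∀ C : Circuit (Fin n), C.IsSimpleBinary → C.Computes (f ∘ boolOfZMod2) →
      (12.8 : ℝ) * ((n : ℝ) - 2 * d - 2) ≤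
        (C.size : ℝ) + 9.6 * (C.influentialCount : ℝ) + 0.2 * (C.troubledCount : ℝ)

/-- **Theorem 3.9 of Li–Yang made explicit**: Thm. 4.1 (`LiYang2022_measure_ge`) and Lemma 3.7
(`LiYang2022_troubledCount_le`, proved above) imply the explicit bound
`12.8 (n - 2d - 2) - 9.6 n - 0.2 (n/2 + 5d/2) ≤ |C|` (`= 3.1 n - 26.1 d - 25.6`) for every H21
circuit over `B2` computing an affine disperser for dimension `d` (the named fact
`LiYang2022_size_ge` of `CircuitLowerBoundsLiYang.lean`): for `n ≥ 2` binarize the circuit (same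
size, same function, simple binary) and use `i ≤ n`; for `d = 0` there is no disperser, and for
`n ≤ 1`, `d ≥ 1` the bound is negative (Li–Yang 2022, Thm. 3.9 and proof of Thm. 1.1).
[cite: LiYang2022, Thm. 3.9] -/
theorem size_ge_of_measure_ge (h41 : LiYang2022_measure_ge)
    (n d : ℕ) (f : (Fin n → ZMod 2) → Bool) (hf : IsAffineDisperser f d)
    (C : Circuit (Fin n)) (hB : C.IsOver B2) (hC : C.Computes (f ∘ boolOfZMod2)) :
    (12.8 : ℝ) * ((n : ℝ) - 2 * d - 2) - 9.6 * n - 0.2 * ((n : ℝ) / 2 + 5 * (d : ℝ) / 2) ≤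
      (C.size : ℝ) := by
  rcases Nat.eq_zero_or_pos d with rfl | hd
  · exact absurd hf (not_isAffineDisperser_zero f)
  have hd' : (1 : ℝ) ≤ d := by exact_mod_cast hd
  have hsz0 : (0 : ℝ) ≤ C.size := Nat.cast_nonneg _
  rcases lt_or_ge n 2 with hn | hn
  · have hn' : (n : ℝ) ≤ 1 := by exact_mod_cast Nat.lt_succ_iff.mp hn
    linarith
  · set x₀ : Fin n := ⟨0, by omega⟩
    set x₁ : Fin n := ⟨1, by omega⟩
    have h01 : x₀ ≠ x₁ := by simp [x₀, x₁, Fin.ext_iff]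
    have hS : (C.binarize x₀ x₁).IsSimpleBinary := C.isSimpleBinary_binarize h01
    have hC' : (C.binarize x₀ x₁).Computes (f ∘ boolOfZMod2) := Circuit.computes_binarize hB hC x₀ x₁
    have h1 := h41 n d f hf _ hS hC'
    have h2 : (2 : ℝ) * ((C.binarize x₀ x₁).troubledCount : ℝ) ≤ n + 5 * d := by
      exact_mod_cast LiYang2022_troubledCount_le n d f hf _ hC'
    have h3 : ((C.binarize x₀ x₁).influentialCount : ℝ) ≤ n := by
      have := (C.binarize x₀ x₁).influentialCount_le_card
      rw [Fintype.card_fin] at this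
      exact_mod_cast this
    have hsz : ((C.binarize x₀ x₁).size : ℝ) = C.size := by rw [Circuit.size_binarize]
    linarith

/-- The explicit bound with the constants collected: `3.1 n - 26.1 d - 25.6 ≤ |C|`.
[cite: LiYang2022, Thm. 3.9] -/
theorem size_ge_of_measure_ge' (h41 : LiYang2022_measure_ge)
    (n d : ℕ) (f : (Fin n → ZMod 2) → Bool) (hf : IsAffineDisperser f d)
    (C : Circuit (Fin n)) (hB : C.IsOver B2) (hC : C.Computes (f ∘ boolOfZMod2)) :
    (3.1 : ℝ) * n - 26.1 * d - 25.6 ≤ (C.size : ℝ) := by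
  have := size_ge_of_measure_ge h41 n d f hf C hB hC
  linarith


/-! ### From Theorem 4.1 to `LiYang2022_size_ge` and `li_yang` -/

/-- **Theorem 4.1 implies the vendored explicit bound.** The named fact `LiYang2022_measure_ge`
(Thm. 4.1, the gate-elimination case analysis) together with Lemma 3.7 (proved above as
`LiYang2022_troubledCount_le`) yields the named fact `LiYang2022_size_ge` of
`CircuitLowerBoundsLiYang.lean` (`12.8 (n - 2d - 2) - 9.6 n - 0.2 (n/2 + 5d/2) ≤ |C|` for every
`B₂`-circuit computing an affine disperser for dimension `d`), so that the only unproved input to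
`li_yang` is Thm. 4.1 (Li–Yang 2022, Thm. 3.9 and proof of Thm. 1.1).
[cite: LiYang2022, Thm. 3.9] -/
theorem LiYang2022_size_ge_of_measure_ge (h41 : LiYang2022_measure_ge) : LiYang2022_size_ge :=
  fun n d f hf C hB hC => size_ge_of_measure_ge h41 n d f hf C hB hC

/-- **Li–Yang's Theorem 1.1 from Theorem 4.1.** The named fact `LiYang2022_measure_ge` (the
gate-elimination case analysis) implies `li_yang` (pnp.S23): with Lemma 3.7 (proved) it gives
`3.1 n - 26.1 d - 25.6 ≤ |C|` (`LiYang2022_size_ge_of_measure_ge`, `size_ge_of_measure_ge'`), and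
`e n = 26.1 · d n + 25.6 = o(n)` when `d = o(n)` (`LiYang2022_size_ge.li_yang`;
Li–Yang 2022, proof of Thm. 1.1). [cite: LiYang2022, Thm. 1.1] -/
theorem li_yang_of_measure_ge (h41 : LiYang2022_measure_ge) : li_yang :=
  (LiYang2022_size_ge_of_measure_ge h41).li_yang

end Literature.Computability.Complexity
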